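import Summits.HodgeConjecture.HodgeConjecture.Theses.EndoscopicMiddleDegree
import Literature.AlgebraicGeometry.ShimuraVarieties.SpecialCycleClasses

/-!
# Disproof of `MiddleThetaSpan` — standing adversary's work file (cdisprove; cycles 1–3, 2026-08-16)

Crux `stmt-HodgeConjecture-13661` = `EndoscopicMiddleDegree.MiddleThetaSpan` (route
`route-HodgeConjecture-EndoscopicMiddleDegree`, rank 2, THE HEART): for `m ∈ {1,2}`, every RATIONAL
Hodge `(m+1,m+1)`-class on a compact arithmetic `2(m+1)`-ball quotient `X(ℂ) ≅ Γ\𝔹` (datum `D`)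
lies in `SC^{m+1}(D) ⊔ span{s ∪ d : s ∈ SC^m(D), d ∈ N¹H²} ⊔ span{a ∪ d : a ∈ Hdg^{m,m}_ℚ, d ∈ N¹H²}`.

NO KILL in cycle 1. This file records, as Lean where possible, what was tried and why the
statement resists; prose lives in docstrings. Findings:

* **F1 — no junk / vacuity kill (confirmed).** Every `∀`-bound object is a field-rich hypothesis
  structure (`UnitaryBallQuotientDatum`: CM subfield of `ℂ`, anisotropic hermitian Gram matrix of
  signature `(p,1)` at `τ₁` and definite elsewhere, torsion-free congruence `Γ`, a uniformisation
  `unif` whose fibres are the `Γ·ℂˣ`-orbits with `X(ℂ) ≃ₜ Γ\𝔹` PROVED, `IsSmoothProjective p X`,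
  special subvarieties pinned on complex points with codimension `≥ dim W`). No `PUnit`/zero/empty
  model: `surjOn_unif` + `unif_eq_unif_iff` force `X(ℂ)` to be an honest `Γ\𝔹⁴` or `Γ\𝔹⁶`; the
  fields are mutually consistent (anisotropy forces `[F:ℚ] ≥ 2` for `p ≥ 2` by Hasse–Minkowski on
  the trace form, which BMM's compact quotients satisfy). The first summand is not junk-`⊤`:
  `le_coheight_of_mem_specialSubvariety` excludes the generic point from every `c(W)`, `dim W ≥ 1`.
  Consequence: an UNCONDITIONAL `¬ MiddleThetaSpan` needs a genuine datum, which the tree cannot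
  build (no compact unitary Shimura variety exists as a `Scheme`); every negative result below is
  therefore structural (implications between variants), not a witness.
* **F2 — the route's "cheapest falsifier" (archimedean) PASSES; the mechanism is alive at `τ₁`.**
  A. Paul, *Howe correspondence for real unitary groups II*, Proc. AMS 128 (2000), Thm 3.4 (read,
  pp. 3131–3132): for a discrete series of `U(p,q)` with Harish-Chandra parameter
  `λ = (a₁…a_k, 0^z, b₁…b_l ; c₁…c_m, 0^w, d₁…d_n)` and `z + w ≥ 1`, `θ_{r,s}(π) ≠ 0` for the unique
  `(r,s)`, `r+s = p+q-1`, with `r = k+n+u`, `s = m+l+v`, `(u,v) = (w-1,z)` when `z < w`. The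
  cohomological discrete series `A(n,n)` of `U(2n,1)` has `λ = (n,…,1,-1,…,-n ; 0)`:
  `k = l = n`, `m = n' = 0`, `z = 0`, `w = 1`, so `(u,v) = (0,0)` and `(r,s) = (n,n)`:
  `A(2,2) ↔ U(2,2)` and `A(3,3) ↔ U(3,3)`, the partner `Γλ = (n,…,1 ; -1,…,-n)` being the
  holomorphic discrete series — exactly the Kudla–Millson source. Kill criterion (ii) of the route
  does not fire. (Caveat: Paul's condition "λ contains 0" is not invariant under central twists;
  BMM's splitting characters are the ones putting the `0` in the `U(1)`-slot.)
* **F3 — R1, the fixed-level product shape, is the one live kill pattern; the typed summand 2 is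
  smaller than what the mechanism delivers.** BMM prove the product statement for the TOWER:
  Thm 71 (arXiv:1306.1515 p. 39 L131–139, proof p. 40) is about `Sh(G)` and uses PRODUCT Schwartz
  functions `ϕ_f = ϕ_{1f} ⊗ ϕ_{2f}` (p. 40: "is a dense subspace of 𝐒(𝕏(𝔸_f))"), with the first
  factor the SPLIT space `W_{a-1,a-1}` (genuine special cycles) and only `W₂` possibly non-split
  (p. 40 eq. (Wdec)). At a fixed level `K` (= one datum `D`) a `K`-invariant class is
  `e_K(Σⱼ [Z'ⱼ] ∪ h'ⱼ)` with `Z'ⱼ` special and `h'ⱼ ∈ H^{1,1}` at a DEEPER level `K'`; each term is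
  supported on the image of `Z'ⱼ`, a codimension-`m` special cycle `c_K(Wⱼ)` of `X_K`, but it is NOT
  of the typed form `s ∪ d` with `d ∈ N¹H²(X_K)` (averaging does not commute with `∪`). So even a
  complete success of the expected proof lands in
  `SCsupp D m := ⨆_{W, dim W = m} classesSupportedOn X (c(W)) (2(m+1))`, not in summand 2.
  PROVED here: `spanCup_le_scSupp` (summand 2 ≤ SCsupp) and `widened_of_middleThetaSpan`
  (`MiddleThetaSpan → MiddleThetaSpanWidened`), i.e. the repaired statement `C′ :=
  MiddleThetaSpanWidened` is formally WEAKER; a fixed-level witness against the typed span that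
  lies in `SCsupp` would make the crux `refuted-misstated` with repair `C′`. No such witness is in
  print (it needs `dim H^{1,1}(X_K)` and `Hdg^{2,2}_ℚ(X_K)` of an explicit compact `U(4,1)`-quotient).
  WHY BMM's own fixed-level statements survive averaging and ours does not: their Thm 1 / Cor 2
  (p. 3, stated for `S = S(Γ)`) are CONIVEAU statements (`N^c H^n(S,ℚ) = …`), and coniveau is
  preserved by the trace from a finite cover (a product `[Z'] ∪ h'` at level `Γ'` is a push-forward
  from `Z'`, its trace is a push-forward from the image of `Z'`); the PRODUCT shape of Remark 3
  (p. 3 L60: "a linear combination … of cup products of (1,1) classes and … special cycles") is the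
  informal gloss of the tower-level Thm 71. RECOMMENDED REPAIR `C″ := MiddleThetaSpanOnSpecial`
  (below): summand 2 ↦ classes supported on codimension-`(m+1)` Zariski-closed subsets OF the
  codimension-`m` special cycles. It is R1-proof for the mechanism (`e_K([Z']∪h')` is `ι_*` of a
  divisor class of the sub-ball quotient `c_K(W)`, `H^{1,1}` of which is `NS ⊗ ℂ` by Cor. 62 since
  `dim c(W) = m+2 ≥ 3`), keeps the theta content (cycles ON special cycles), and its glue to the
  target is PROVED here with no moving lemma for that summand (`middleDegreeStep_of_onSpecial`:
  `CupProductAlgebraic → C″ → MiddleDegreeStep`). `MiddleThetaSpan → C″` holds on paper (moving the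
  divisor on the sub-quotient) but is not formal; `MiddleThetaSpan → C′` is (`widened_of_middleThetaSpan`).
  R1 EXPOSURE LOCUS (where a fixed-level witness must be sought; tempered singleton type
  `ψ = Ψ₄ ⊞ χ₀`, `χ₀` of finite order, `m = 1`). (i) No "incoherent" escape: the constituents are
  conjugate-orthogonal, the splitting character `χ_W` of the pair `(U(V₅), U(W₄))` is conjugate-
  orthogonal too (`χ_W|_{𝔸_F^×} = ω^{dim W} = 1`) and may be taken `= χ₀`; the going-down dichotomy
  picks `W₄,v` by the packet character `η_{π_v}(e_{χ₀})` (Atobe–Gan), and Arthur–Mok multiplicity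
  `∏_v η_{π_v} = ε_ψ = 1` (tempered) is exactly coherence of `{W₄,v}` — automorphic ⟺ lifts from a
  GLOBAL `W₄` (GGP arXiv:0909.2999 Prop. 5.2 read: conjugate-orthogonal root numbers are `+1`, so no
  sign obstruction can even be phrased through `ε(1/2, Ψ₄ × χ₀⁻¹)`). (ii) `W₄` has signature `(2,2)`
  at EVERY real place: at the compact places Paul's formula gives `θ(𝟙_{U(5,0)}) ↔ U(2,2)`
  (`λ = (2,1,0,-1,-2;∅)`, `z = 1 > w = 0`, `(u,v) = (0,0)`, `(r,s) = (2,2)`), so compact places never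
  force a definite `W₄`. (iii) Hence `W₄` is split iff `η_{π_v}(e_{χ₀}) = +1` at all finite `v`;
  the R1-exposed classes are exactly the automorphic `π` with `η_{π_v}(e_{χ₀}) = -1` on a non-empty
  (even, after archimedean signs) set `T` of finite places — they exist as soon as `Ψ₄,v` is an
  irreducible conjugate-orthogonal parameter at two inert places (non-generic supercuspidal members)
  — and for them `SC²_K` projects to ZERO on `M[π_f]` (no KM lift from split `U(2,2)`), so the crux
  at level `K` demands `c_π ∈ e_π(H^{1,1}(X_K)·H^{1,1}(X_K))`, products of a special-divisor theta
  class with a theta class from the plane `W₂″` anisotropic at `T`. A level `K` with `π_f^K ≠ 0` but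
  `e_π(Sym² H^{1,1}(X_K)) ∌ c_π` would be the misstatement witness; deciding it needs the local map
  `τ_{1,v}^{K_v} ⊗ τ_{2,v}^{K_v} → π_v^{K_v}` at `v ∈ T` (depth is preserved by theta, Pan), not
  available here.
* **F4 — calibration `m = 0` (PROVED): the same sentence at `m = 0` (Picard modular surfaces) is
  EQUIVALENT to Lefschetz `(1,1)` on those surfaces** (`atZero_iff_lefschetz`): `SC⁰ = H⁰ ∋ 1` and
  `1 ∪ d = d`, so summand 2 swallows `N¹H²`. Hence the Blasius–Rogawski classes (rational `(1,1)`,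
  not special) are absorbed at `m = 0` by the product summand, and the guard `1 ≤ m` is not where
  the BR phenomenon is excluded — at `m = 1` the absorber only offers `NS·NS`.
* **F5 — packets ("cores") cannot yield a kill short of `¬HC`.** For `ψ = Ψ₄ ⊞ χ₀` on `U(4,1)`
  with `χ₀` off-centre at every real place (the even core the r1 triage asked this seat to watch),
  the `π_f`-isotypic Hodge structure `N = ⊕_σ M[σπ_f]` has ONE `(2,2)`-line per conjugate inside a
  rank-4 piece whose `ℓ`-adic realisation is `r(Ψ₄) ⊗ χ'`, irreducible for a density-one set of `ℓ`
  (Calegari–Gee 2013, `n ≤ 5`); a rational `(2,2)`-class in `N` would generate a `T`-line of Hodge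
  classes with no Tate companions, i.e. a counterexample to HC itself. Same for stable `Ψ₅`. So the
  "CoreVanishing" half of the crux is implied by HC and is not attackable; only the theta half
  (singleton `M[π_f]`, `χ₀` of finite order, genuinely rational Tate-type classes) can fail, and
  there only through F3 or the ε-dichotomy/level issues (previous seat's R1–R3).
* **F6 — strengthenings recorded, none refutable here.** `MiddleThetaSpanAllHodge` (drop
  `IsRationalClass`) trivially implies the crux (`middleThetaSpan_of_allHodge`); BMM's "if a = b this
  is no longer true" (p. 5 L73) refers to `SC^{2a}` ALONE and is cured in print by the `H^{1,1}`
  factor, so it is NOT a printed counterexample to the all-Hodge version either (cup products are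
  not confined to endoscopic packets). Status unknown; do not rely on it.

* **F7 — which non-tempered packets carry `A(2,2)` at `p = 4` (coordinate count, for the provers).**
  With trivial coefficients the `τ₁`-coordinates are `{2,1,0,-1,-2}` and `A(2,2)` is the discrete
  series whose `U(1)`-slot holds `0`. (a) `η⊠R₃ ⊞ χ₁ ⊞ χ₂`: the `R₃`-block is `{c+1,c,c-1} ∋ 0`
  always, so its DS member has `U(1)`-slot `≠ 0` — this CAP family (named in the route's kill
  criterion (i)) NEVER carries a primitive `(2,2)`-class; it only feeds `L·H^{1,1}` (summand 3).
  (b) `(ρ⊠R₂) ⊞ χ₀`, `ρ` cuspidal on `GL₂/E` of type `(3/2,-3/2)`, `χ₀` central: blocks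
  `{2,1} > {0} > {-1,-2}` in good position, AJ packet with three members, the one with the
  non-compact slot in the `χ₀`-block has compact Levi `U(2)×U(1)×U(2)`, i.e. IS the DS `A(2,2)`.
  So GL₂-CAP packets already carry primitive rational Tate-type `(2,2)`-classes at `p = 4` (the
  route text places them at `p = 5`); `χ₀` of finite order makes the whole `ℚ`-piece of type
  `(2,2)`. They are reached WITHOUT products by the direct Kudla–Millson lift from `U(2,2)`
  (hermitian Maass-type forms; `K`-invariant Schwartz functions suffice, no R1) exactly when the
  dichotomy space `W₄` is split at every finite place; otherwise `W₄ = H ⊕ W₂″` and the class is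
  R1-exposed like the tempered ones. Any proof of the crux must treat `Ψ' = ρ⊠R₂` in its "pole at
  `s = 1` ⟹ theta" step (extra poles of `L(s, π × χ₀⁻¹)` from the `R₂` block).

Targets (lead's stuck stubs): none yet (payload `stuck_stubs = []`). Pre-read of the registered
skeleton `Lines/lefschetz-one-rank-down.lean`: R1 (F3) bites `stub_thetaSpan` (fixed-level
`thetaSpan`); F5 says `stub_residual` (CoreVanishing residue) is refutable only by `¬HC`;
`stub_downstairs` is true (Lefschetz (1,1) + Hodge index). No cheap kill among the six stubs.

## Cycle 2 (2026-08-16) — findings F6′, F8, F9, F10, F11, targets T1–T6. Still NO KILL; new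
PROVED structural lemmas, one refuted strengthening (on paper), one quantitative near-miss, one finite
falsifier designed. LANDED (Negative lane, `--supports stmt-HodgeConjecture-13661`, all ACCEPTED
2026-08-16T02:06Z, axioms ⊆ {propext, Classical.choice, Quot.sound}): p75146
`Summits.HodgeConjecture.HodgeConjecture.Theorems.MiddleThetaSpan.Negative.SupportWidening` (F3: crux ⟹
C′, `mem_widened_of_middleThetaSpan`), p75147 `….Negative.TwoSummands` (F9,
`mem_twoSummands_of_middleThetaSpan`), p75149 `….Negative.AtZeroLefschetz` (F4, `atZero_iff_lefschetz`),
p75152 `….Negative.RankBound` (F8 `rank_map_span_ratHodge_le_of_middleThetaSpan`, F11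
`rank_map_span_ratHodge_le_of_middleThetaSpan_one`, `rank_map₂_le`). Ideators/planners/leads: import these
modules rather than this work file.

* **F6′ — the all-Hodge strengthening (F6) is FALSE at every deep level; `IsRationalClass` is
  load-bearing, definitively.** Seesaw: every generator of the three-summand span is
  theta-isotypic — `SCⁿ_K` lies in Kudla–Millson lifts from SPLIT `U(n,n)`; every `(1,1)`-class on
  `X_K` is `L` or a theta lift from some `U(W₂)` (BMM Thm 4 at `a = b = 1`, in range for `p ≥ 4`);
  and `θ(f₁,W₂) ∪ θ(f₂,W₂') = Σ_σ P_{U(W₂)×U(W₂')}(σ; f₁⊠f₂) · Θ_{φ₁⊗φ₂}(σ)`, `σ` on `U(W₂ ⊕ W₂')`,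
  whose lifts have ENDOSCOPIC parameters `Ψ' ⊞ χ`. Hence the Hecke projector `e_π` onto a STABLE
  tempered `Ψ₅`-piece (`π_∞ = A(2,2)`) kills the whole span, while `e_π H^{2,2}(X_K) ≠ 0`; such `π`
  exist at deep level (limit multiplicity `≍ vol ≍ N𝔫^{25}` against `≪ N𝔫^{21+ε}` for all endoscopic
  shapes, Marshall–Shin arXiv:1804.05047 Prop. singlefinite + Savin). Formal hook:
  `middleThetaSpanAllHodge_false_of_hasNonThetaHodgeClass` (the hypothesis `HasNonThetaHodgeClass`
  is exactly "a `(n,n)`-class seen by an endomorphism killing the span"; its docstring carries the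
  instance). The rational twin `middleThetaSpan_false_of_rational_nonThetaClass` needs a RATIONAL such
  class = a rational class in a stable/core piece = F5 (not short of `¬HC`).
* **F8 — the level-aspect DIMENSION COUNT against the product shape (R1) does NOT bite.** PROVED
  `rank_map_ratHodgeSpan_le_of_middleThetaSpan`: for every endomorphism `e` killing `SC^{m+1}`,
  `rk e(Hdg^{n,n}_ℚ⊗ℂ) ≤ rk SC^m · rk N¹ + rk Hdg^{m,m}_ℚ · rk N¹` (via `rank_map₂_le`: rank of a
  bilinear image ≤ product). Intended `e` = projector onto `Π_T(K)` = Tate-type `A(n,n)`-pieces with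
  NON-split dichotomy space (there `SCⁿ_K ↦ 0`, F3 (iii)), so the crux forces
  `dim Π_T(K) ≤ 2·h^{1,1}(X_K)²`-ish at `m = 1`. Exponents in a full-level tower `K(𝔫)` (`p = 4`,
  `N = 5`): Marshall–Shin Thm 1.2 (p. 3, conditional on KMSW; levels at split primes): `h²(X(𝔫)) ≪
  N𝔫^{Nd+1} = N𝔫^{11}`, expected SHARP for the shape `(3,1),(1,2)` = the `A(1,1)`-classes, so the
  right side is `≍ N𝔫^{22}`; the whole Tate-type shape `(1,4),(1,1)` is `≪ N𝔫^{dim GL₅/P_{(4,1)}+16+1+ε}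
  = N𝔫^{21+ε}`. Products of divisor classes OUTNUMBER all Tate-type `(2,2)`-classes by a power of the
  level: no counting refutation; R1 is a question about the local maps / `U(2)×U(2)`-periods of
  F3 (iii), not about dimensions. (Same verdict at `m = 2`: `(h^{2,2}·h^{1,1}) ≍ N^{(7·4+1)+(7·2+1)} =
  N^{44}` vs Tate shape `(1,6),(1,1)`: `N^{6+36+1} = N^{43}`.)
* **F9 — summand 2 is decorative (PROVED modulo the textbook diagonal-type fact).**
  `middleThetaSpan_iff_twoSummands : SpecialClassesDiagonal → (MiddleThetaSpan ↔
  MiddleThetaSpanTwoSummands)`: since `SC^m` is the complex span of its rational classes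
  (`specialCycleClasses_eq_span_isRationalClass`) and those are of type `(m,m)`
  (`SpecialClassesDiagonal`, Voisin I Prop. 11.20 — in the tree only modulo
  `hodgePQ_independent_of_hodgeModel`), `SC^m·N¹ ≤ Hdg^{m,m}_ℚ·N¹`. So the crux reads
  `Hdg^{n,n}_ℚ ⊆ SCⁿ ⊔ Hdg^{n-1,n-1}_ℚ·N¹`; at `m = 1` (with Lefschetz (1,1) and BMM Cor. 62 for `H^{1,1}`,
  `p ≥ 3`): `Hdg^{2,2}_ℚ ⊆ SC² + NS·NS`. The summands are `Submodule.map₂ (∪)` images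
  (`span_cup_eq_map₂`, `span_cup_eq_map₂_span`) — the form in which rank bounds apply.
* **F10 — WHERE R1 can bite: only data with non-hyperspecial level at ≥ 2 non-split places.** For a
  Tate-type `π = A(2,2) ⊗ π_f` (parameter `Ψ₄ ⊞ χ₀`, `χ₀` of finite order) let `T(π)` = finite places
  where the dichotomy space `W₄(π)_v` is the NON-split one. (a) `T(π) ⊆ S_D :=` {places where `K_v`
  (the closure of `Γ`) is not hyperspecial} ∪ {places ramified in `E/F`}: at `v ∉ S_D`, `π_v` is
  `K_v`-spherical, hence the base point of an unramified packet, hence `θ`-related to the split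
  `W₄,v` (unramified Howe duality; Atobe–Gan arXiv:1602.01299 Thm 4.1, read p. 10: for the pair
  `(U(W₅), U(V₄))`, `κ = 1`, a tempered `π_v` has a 4-dimensional lift iff `l(π_v) ≥ 0`, which forces
  `φ_v ∋ χ_V` — so non-Tate `π_v` lift to NO `W₄,v` — and the receiving tower is `𝒱^{η(z_φ + e₁)}`,
  `e₁ ↔ χ_V`: the label bookkeeping of F3). (b) `|T(π)|` is
  EVEN: Arthur–Mok/KMSW multiplicity `∏_v η_{π_v} = ε_ψ = 1` is coherence of `{W₄(π)_v}` (F3 (i)), and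
  `T = ∅` is realised (KM lifts from split `U(2,2)` with `A(2,2)` at `τ₁` by Paul, F2, and `𝟙` at the
  compact places, F3 (ii)), which fixes the archimedean parity. (c) At SPLIT places packets are
  singletons and `W₄,v` is unique: no contribution to `T`. CONSEQUENCE: if `S_D` contains at most ONE
  non-split place then `T(π) = ∅` for every Tate-type `π` at level `D`, every such class is a KM lift
  from split `U(2,2)` with a `K`-invariant Schwartz function, i.e. lies in `SC²(D) +` Lefschetz terms
  — NO R1 exposure at all (modulo the a = 1 global criterion). In particular Marshall–Shin's towers
  (split level) and one-prime inert towers `K^𝔭 K_𝔭(𝔭^k)` are R1-safe; a misstatement witness must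
  live at a level ramified at two inert/ramified places `{𝔭, 𝔮}` with `π_𝔭, π_𝔮` the non-base members
  (e.g. `Ψ₄,v ⊇` a conjugate-orthogonal discrete summand at both). Provers: the Tate-type half of the
  crux at one-bad-place levels is the split-`U(2,2)` Kudla–Millson statement, with no seesaw.
* **F11 — the SMALL-LEVEL counting falsifier (the live, finite test of R1; next-cycle kit target).**
  Sharpening F8 with the seesaw: for `π ∈ Π_T(K)` (Tate type, `W₄(π) = H ⊕ W₂⁻` non-split exactly
  at `T`, `|T| ≥ 2`), `e_π` kills `SC²_K`, kills `L · H²` (the `π_f`-isotypic part is purely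
  `A(2,2)`: `A(1,1) ⊗ π_f` cannot also be automorphic, one parameter per `π_f`), kills every product of
  two SPECIAL divisor classes (Kudla–Millson: `θ_{φ₁} ∧ θ_{φ₂} = θ_{φ₁⊗φ₂}|_{U(1,1)²}` with `H ⊕ H`
  split, so `SC¹·SC¹ ⊆ SC² + L·H²`), and `e_π(h₁ ∪ h₂) ≠ 0` for theta divisors `hᵢ = θ(fᵢ, W₂⁽ⁱ⁾)`
  needs `W₂⁽¹⁾ ⊕ W₂⁽²⁾ ≅ W₄(π)`, whence at each `v ∈ T` one of the two planes is ANISOTROPIC at `v`.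
  So with `D₂(K) :=` the span of the `(1,1)`-classes at level `K` that are theta lifts from
  2-dimensional hermitian spaces anisotropic at some `v ∈ T`, `d₂(K) := dim D₂(K)` (every
  `(1,1)`-class is `L`, special, or a theta divisor: BMM Thm 4 at `a = b = 1`), the two-summand form
  F9 gives: MiddleThetaSpan at level `K` ⟹ `Π_T(K) ⊆ e_{Π_T}(H^{1,1}(X_K) ∪ D₂(K))`, hence
  `dim Π_T(K) ≤ h^{1,1}(X_K) · d₂(K)` (PROVED as the formal shape
  `rank_map_ratHodgeSpan_le_of_middleThetaSpan_one`: `e` killing `SC²` and `Pₛ·Pₛ`, `N¹ ≤ Pₛ ⊔ D₂`,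
  Lefschetz (1,1) as hypothesis ⟹ `rk e(Hdg^{2,2}_ℚ⊗ℂ) ≤ rk(Pₛ ⊔ D₂)·rk D₂`). In particular
  `d₂(K) = 0 < dim Π_T(K)` refutes the crux at `K` (misstated; `C′`/`C″` survive, the classes being
  traces of products from deeper level, supported on special divisors). All three numbers are FINITE and computable at small level through
  DEFINITE TWINS: `dim Π_T(K)` = number of trivial-weight algebraic modular forms on the definite twin
  `U(V')` (idea definite-twin-theta, triage r1-1 pass) with parameter `Ψ₄ ⊞ χ₀` and non-base members
  at `T` — class numbers / Hecke modules of rank-5 hermitian genera with parahoric level at `T`;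
  `d₂(K)` = quaternionic (Jacquet–Langlands side of `U(W₂'')`, `B` ramified at the `T`-places) forms
  of the weight matching `A(1,1)` at `τ₁` and `𝟙_{U(5,0)}` at the other real places, level `1` outside
  `S_D`, prescribed type on the compact `U(W₂''_v)`, `v ∈ T`; `h^{1,1}(X_K)` from these and the split
  `U(1,1)` (weight-5 hermitian modular forms). In the level aspect products win (F8: `N^{22}` vs
  `N^{21}`), so the test must be run at the SMALLEST levels with two bad inert places (`F` real
  quadratic, `K_𝔭, K_𝔮` parahoric / pro-unipotent): there `d₂(K)` can plausibly vanish while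
  `Π_T(K) ≠ 0` (depth-zero non-base members exist as soon as `Ψ₄,v` has a depth-zero
  conjugate-orthogonal discrete summand). Not run this cycle (needs hermitian-lattice class number
  code; kit job design recorded in the seat's NOTES). The `m = 0` shadow of the phenomenon is real:
  on a Picard modular surface with `q(X_K) = 0`, BMM's product shape `θ(W₁) ∪ θ(W₁')`
  (`H^{1,0}·H^{0,1}`) for anisotropic-`W₂` Tate divisors is EMPTY at level `K` although the classes
  exist (they are `e_K` of products at deeper level) — harmless there only because the typed `m = 0`
  sentence offers the factor `H⁰` (F4), which has no analogue at `m = 1`.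
  WHY THE COUNT IS (ESSENTIALLY) THE WHOLE STORY. BMM's proof of Thm 71 (arXiv:1306.1515 p. 40, read
  this cycle) generates `H^{b×q,a×q}(Sh(G))` by the VALUES `[θ_φ(g′,·)]`, `g′ ∈ G′(𝔸)`, and uses
  `θ_{ω(g₁′)φ}(g′,·) = θ_φ(g₁′g′,·)` plus density of pure tensors — adelic translates of a rational
  decomposition, hence no fixed level. At level `K`, for `π = Θ(σ) ∈ Π_T(K)`: `π^K = Θ_{ω^K}(u₀)` for ANY
  `u₀ ≠ 0` in `σ` (`Θ(ω(h)φ ⊗ σ(h)u) = Θ(φ ⊗ u)` and `ω(h)ω^K = ω^K` for `h ∈ U(W)(𝔸)`), whereas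
  level-`K` products give `λ(e_π(D₁(g₁) ∪ D₂(g₂))) = F_{λ,φ₁⊗φ₂}(ι(g₁,g₂))` with `F_{λ,φ} := λ ∘ e_π ∘ θ_φ ∈ σ`:
  R1 fails at `K` iff some `λ ≠ 0` on `π^K` has ALL `F_{λ,φ₁⊗φ₂}` (`φᵢ ∈ ωᵢ^K`) vanishing on the
  sub-Shimura variety `[U(W₂)×U(W₂′)]` — a finite linear condition, i.e. exactly the spanning count.
  Locally there is no further obstruction at depth-zero level `K_v = P_V⁺`: `ω^{P_V⁺×P_W⁺}` is the Weil
  representation of the finite reductive quotients, multiplicative in lattice-compatible orthogonal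
  decompositions (`= Ω₁ ⊗ Ω₂ ⊆ ω₁^{P_V⁺} ⊗ ω₂^{P_V⁺}`), and depth is preserved by theta (Pan), so the
  `U(W⁻)`-span of pure `K_v`-invariant tensors is all of `ω^{K_v}`. Hence at such levels R1 ⟺ the
  global inequality of F11 fails — the test is sharp, not merely necessary.
* **Targets pre-read (registered skeleton `lefschetz-one-rank-down`, 6 active stubs; payload
  `targets = []`).** T1 `stub_heckeOperators` / T2 `stub_matsushima`: the pins are SOUND — `T g` is
  constrained (`isHecke`) and used (`InHeckeAlgebra.gen`, `central`, `primitive`) only for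
  `g ∈ U(V)(F)`, so junk values at non-unitary `g` buy nothing, and `IsHeckeReps` data exist on paper
  for every unitary `g` (`Γ' := ⋂ⱼ (gⱼ⁻¹ Γ gⱼ ∩ Γ)`); the HS-projector fake of the line card's own
  warning is excluded. Residual typed risk: the `hodgeType` clauses quantify over ALL `HodgeModel`s, so
  T1 silently contains a slice of `hodgePQ_independent_of_hodgeModel` (harmless on paper: natural
  automorphisms of `Hᵏ(-;ℂ)` are scalars). T3 `stub_thetaSpan`: carries R1; by F10 only the ≥ 2-bad-place
  levels are exposed; by F8 no counting kill. T4 `stub_transporter`: (i) `IsTransporter.perp` is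
  AUTOMATIC for any `ℚ`-HS morphism `φ` on a piece `N` WITHOUT rational Hodge classes
  (`x ↦ (d ↦ φ x ∪ d)` is an HS-map `N(1-n) → NS(S)^∨(-2) ≅ ℚ(-1)^ρ`, zero unless `N ∋` a Hodge class) —
  so for genuine cores and killed CM pieces only `rational/type/ker` carry content; (ii) `ker` forces
  injectivity modulo the span on ALL of `N` (the zero map is never a transporter since
  `N^{n+1,n-1} ⊄ thetaSpan`) — consistent, strong; no paper counterexample (3+2 = Tate prediction).
  T5 `stub_downstairs`: true (Lefschetz (1,1) + Hodge index on `NS_ℚ`, base-changed). T6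
  `stub_residual`: = F5. No stub kill; nothing to file as `stub-false`.

## Cycle 3 (2026-08-16, seat g3) — F12: THE CRUX IS FALSE AT `m = 1` ON PAPER (ε-negative GL₂-CAP pieces);
F13: status of the repairs `C′`/`C″`; F14: where the expected proof breaks; Targets = the picked skeleton
`conjugate-dimension-sieve` (`stub_singletonSpan` is the doomed stub). Formal product: NEGATIVE LEMMA MODULO
`H := HigherBlasiusRogawskiClassAtFour` (`middleThetaSpan_false_of_higherBlasiusRogawskiClassAtFour`, this
file §EpsNegativeCAP; landed copy `Theorems/MiddleThetaSpan/Negative/HigherBlasiusRogawskiAtFour.lean`,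
proposal id in the seat's NOTES/HANDOFF). Paper verdict: `refuted-substantive` MODULO the Arthur–Mok
multiplicity formula (AMF) for one NON-generic parameter on the inner form `U(V)` — the same endoscopic
classification (Mok arXiv:1206.0882 Thm 2.5.2 quasi-split; Kaletha–Minguez–Shin–White arXiv:1409.3731, whose
published volume is generic-only, sequels announced) on which BMM and the route's own expected proof rest.
Formal verdict: the item stays OPEN but should be HELD; planners read `route-negative-lemma`.

* **F12 — ε-negative GL₂-CAP pieces carry RATIONAL Hodge `(2,2)`-classes invisible to every theta lift from
  a 4-dimensional hermitian space, hence outside `SC² ⊔ H²·H² ⊇` the typed span (corrects F7(b), which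
  only saw the coherent members).** Setting: `m = 1`, `p = 4`, `d = [F:ℚ] ≥ 2`; `ρ` conjugate-symplectic
  cuspidal on `GL₂(𝔸_E)` with `ρ_w ≃ (z/z̄)^{3/2} ⊕ (z/z̄)^{-3/2}` at each complex place (e.g.
  `ρ = BC_{E/F}(π_f)`, `π_f` a Hilbert newform of parallel weight 4, trivial character: `BC` of a symplectic
  parameter is conjugate-symplectic), SUPERCUSPIDAL at a finite place `v₀` NOT split in `E` (e.g. `π_f` of
  depth-zero supercuspidal type at an inert prime; then `ρ_{v₀} ⊗ S₂` is an irreducible discrete parameter — the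
  Steinberg case should behave identically, cf. Schmidt's Saito–Kurokawa packet `{VIb, VIc}`, but is not checked
  here); `χ₀` conjugate-orthogonal of finite order (on the connected `Γ\𝔹` one may twist
  to `χ₀ = 1`); `ψ := ρ ⊠ R₂ ⊞ χ₀`. The four steps, each checked this cycle against the printed sources:
  (1) ARCHIMEDEAN (recomputed): among the three exponent configurations `(p,q;r) ∈ {(3/2,-3/2;0),
  (3/2,-1/2;-2), (1/2,-3/2;2)}` giving infinitesimal character `(2,1,0,-1,-2)`, the discrete-series member of
  the Adams–Johnson packet (non-compact coordinate in the `χ₀`-block, `L = U(2)×U(0,1)×U(2)` compact) has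
  Hodge type `(#blocks above, #blocks below) = (2,2)`, `(4,0)`, `(0,4)` respectively; only `r = 0` (χ₀ trivial at
  ∞) matters, and there the other two members have types `(0,3)+(1,4)`, `(3,0)+(4,1)`. So `H⁴[Π_f]` is PURE
  `(2,2)`, `H²[Π_f] = 0`, for `Π_f` and all its `Aut(ℂ)`-conjugates (CAP of the same shape: `σ(BC π_f) =
  BC(σπ_f)`, weight 4 parallel; the half-twist `σ(ν^{1/2}) = ν^{1/2}·quadratic` keeps the shape); the
  `ℚ`-isotypic piece `N_ℚ` of `Π_f` in `H⁴(Γ\𝔹⁴; ℚ)` (generalised eigenspace of the UNRAMIFIED Hecke algebra,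
  which already isolates the packet members with `A(2,2)` at `τ₁`: same `Π_∞`, same a.e. components ⟹ same
  parity of `#T_δ`, see (3)) consists of rational Hodge `(2,2)`-classes, `≠ 0` once `Π_f^Γ ≠ 0`.
  (2) LOCAL PACKET at `v₀` and THETA PARTNERS: `Π_{ψ,v₀} = {J, δ_ng}`; `J` = Langlands quotient of
  `ρ_{v₀}ν^{1/2} ⋊ χ₀`, A-packet character `+` (the L-packet of `φ_ψ` embeds in `Π_ψ` with the pulled-back
  character; `S̄_{φ_ψ} = 1`); `δ_ng` = the NON-generic discrete series of the L-packet `{δ_gen, δ_ng}` of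
  `ρ_{v₀} ⊗ S₂ ⊕ χ₀`, character `−` — forced by STABILITY: `ρν^{1/2} ⋊ χ₀ = [δ_gen, J]` so `Θ_J = −Θ_{δ_gen}` on
  the regular elliptic set, the stable distribution of `ψ` restricted there is `−(Θ_{δ_gen} + Θ_{δ_ng})`
  (Grothendieck-group identity `Ind(Speh) + Ind(St) = Ind(GL₂×GL₂×GL₁)`, whose twisted character misses the
  type-`(4,1)` elliptic tori), hence the second member is `δ_ng` with sign `−1` (equivalently: Aubert duality
  fixes the supercuspidal `δ_ng` and swaps `δ_gen ↔ J`). PARTNERS (Gan–Ichino arXiv:1409.6824, Thm 1.3 =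
  Prasad's (P2) for ALL parameters, and Thm 4.4 (ii) read p. 11: for `φ' = ρ' ⊗ S₂ ∌ χ_V` on `U(W₄^{ε'})`,
  `θ(δ'^{ε'})` to `U(V₅^{ε})` is non-zero for EACH `ε`, has parameter `ρS₂ ⊕ χ₀`, and `θ(η)` restricts to `η`
  on `S_{φ'}` with `θ(η)(z) = ε`): with the Vogan labelling (`δ_gen ↔ (+,+)` on `V⁺`, twisted by
  `κ(x) = (−1)^{dim x⁻}` on `V⁻`) one gets `θ_{W⁺}(δ'⁺) = δ_gen`, `θ_{W⁻}(δ'⁻) = δ_ng` for BOTH `V^±`; by the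
  conservation relation (Sun–Zhu, used ibid. p. 17) `δ_ng` has no theta lift from `U(W₄⁺)` (its `+`-tower
  first occurrence is `12 − 4 = 8`). At every other finite place the member is `J_v` (partner `W_v⁺`, label
  `+`; split places: singleton), at `τ₁` it is `A(2,2)` (partner `U(2,2)`, F2) and at compact places `𝟙`
  (partner `U(2,2)`, F3 (ii)). NORMALISATION `ε(W_v) := ω_{E_v/F_v}(det W_v)`: `(2,2) ↦ +`, `W⁺ = H⊕H ↦ +`,
  `W⁻ ↦ −`, and `∏_v ε(W_v) = 1` for a global `W` (reciprocity). Upshot: `label(Π_v) = ε(partner(Π_v))` at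
  every finite place. (3) MULTIPLICITY (Mok p. 19–20 read: `ε_ψ(x) = ∏' det λ_α(s)` over constituents
  `λ_α ⊗ μ_α ⊗ ν_α` of `τ_ψ = Ad ∘ ψ̃` with `μ_α` symplectic and `ε(½, μ_α) = −1`; here the cross constituent
  `μ = Ind_E^F(ρ ⊗ χ₀⁻¹)` is symplectic — restriction/induction preserves the sign — with `ν = R₂ ⊗ R₁` even,
  `λ(s_ψ) = −1`): `ε_ψ(s_ψ) = ε(½, ρ × χ₀⁻¹)`, and AMF reads: `A(2,2) ⊗ 𝟙^{d−1} ⊗ ⊗_v Π_v` is automorphic iff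
  `A_∞ · (−1)^{#T_δ} = ε(½, ρ × χ₀⁻¹)` with `T_δ = {v : Π_v = δ_ng}` and `A_∞` a CONSTANT sign (archimedean labels
  times the `+` labels of the `J_v`; `κ(s_ψ) = +1` makes the finite labels independent of `V_v^±`; `A_∞ = +1`
  by triage r1-2's label tables / consistency with the non-vanishing Rallis inner product for a coherent lift
  with `L(½)L(3/2) ≠ 0`). Both signs of `ε(½, ρ × χ₀⁻¹)` occur with `v₀` fixed (with `π_f` unramified outside `v₀` and `χ₀ = 1`,
  `ε(½, BC π_f)` is an archimedean constant times the local root number of the depth-zero supercuspidal `ρ_{v₀} ⊗ χ₀,v₀⁻¹` —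
  only square-integrable places contribute, hyperbolic and split places giving `+1` — and that sign takes both
  values at depth zero: by local GGP for `U(V₁) ⊂ U(W₂^±)` it records whether the `U(V₁)`-invariant member of the
  packet of `ρ_{v₀}` lives on `U(1,1)` or on the compact `U(2)`, and a cuspidal representation of `U₂(𝔽_q)` (degree
  `q−1`) restricted to the torus `U₁(𝔽_q)` (order `q+1`) omits two characters, the trivial one for some inducing
  characters only; or vary `χ₀`), so for either value
  of `A_∞` there are automorphic `Π` with `#T_δ` ODD (`T_δ = {v₀}`). [For the sign with `A_∞ · ε = −1` the unique
  automorphic `A(2,2)`-member is the incoherent `δ_{ng,v₀} ⊗ J^{v₀}`; for the other sign it is the coherent `J_f`, and if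
  moreover `L(½, ρ × χ₀⁻¹) = 0` that member is STILL outside the span — its only unobstructed partner is the totally
  split `W⁺`, and `θ_{V→W⁺}(Π) = 0` because the pole at `s = 1` is cancelled (F14; Kudla–Rallis: occurrence below
  the equal-size point forces the pole). The incoherent alternative needs no L-value input.] (4) INCOHERENCE ⟹ INVISIBILITY: the
  partner data of such `Π` have `∏_v ε = −1`: no GLOBAL `W₄` has them, so for every `W₄` (split `H⊕H`, or
  `W₂ ⊕ W₂'` for any two hermitian planes, any splitting characters — a `χ_W`-part `≠ χ₀` kills the lift to
  BOTH `W^±`) some `Π_v` is not a local lift from `U(W₄,v)` and the global lift `θ_{V→W₄}(η̄)`, `η ∈ Π`,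
  vanishes identically (local Howe quotient zero). Hence the projector `e_Π` onto `N_ℚ ⊗ ℂ` (unramified
  Hecke polynomial; commutes with `L ∪ ·` by the projection formula; a morphism of Hodge structures) kills
  `SC²_Γ` (KM Fourier coefficients for split `W₄`; `Π`-component `= FC_β θ_φ(η̄) = 0`), kills `h₁ ∪ h₂` for
  all `hᵢ ∈ H²` (BMM Thm 4: `H^{1,1}_{A(1,1)}, H^{2,0}, H^{0,2}` are theta lifts from planes, `(1,1),(2,0),(0,2)`
  being in range `3(a+b)+|a−b| < 10`; `⟨θ(f₁)∧θ(f₂), η⟩ = ∫_{[U(W₂)×U(W₂')]} f₁f₂ · θ_{V→W₂⊕W₂'}(η̄) = 0`;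
  `L ∪ x ↦ L ∪ e_Π x = 0` since `H²[Π_f] = 0`), and `e_Π ≠ 0` on `N_ℚ ⊗ ℂ ⊆ Hdg^{2,2}_ℚ ⊗ ℂ`. That is `H`, and
  `H → ¬MiddleThetaSpan` is kernel-checked below. CLASSICAL SHADOW confirming the sign/partner bookkeeping:
  holomorphic Saito–Kurokawa lifts of level 1 (`ψ = ρ⊠R₂ ⊕ 𝟙` on `PGSp₄`, `k` even ⟺ `ε(½,f) = −1`) are the
  automorphic members with the single `−` label at `∞`; their dim-4 partner data ("`B` ramified exactly at
  `∞`") are incoherent, so they are theta lifts from `Mp₂` but from NO `GO(V₄)` — invisible in `H^{3,0}`, where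
  it costs nothing; on `U(4,1)` the incoherent members are RATIONAL `(2,2)`. Existence data: Hilbert newforms
  of weight `(4,4)` over a real quadratic `F` with prescribed depth-zero supercuspidal type at a prime inert in
  `E` (unramified elsewhere) exist in abundance; `δ_ng` then has depth zero, so a parahoric-level `Γ` (torsion-free
  after shrinking at a split prime) has `Π_f^Γ ≠ 0`.
* **F13 — the repairs `C′ = MiddleThetaSpanWidened` ⊇ `C″ = MiddleThetaSpanOnSpecial` are NOT formally hit
  by `H`, and on paper die only modulo non-tempered GGP.** The extra classes in `C″` at `m = 1` are
  `ι_*(NS(S_W) ⊗ ℂ)` for special divisors `S_W` (`U(3,1)`-quotients): `ι_*ι^*L = [S_W] ∪ L` (killed) and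
  `ι_*θ_{W₂'→V₄}(f)`; for SPLIT `W₂'` these are push-forwards of special divisors of `S_W`, i.e. special
  2-cycles of `X` (killed); for ANISOTROPIC `W₂'` the `Π`-component is the `U(V₄)`-period
  `∫_{[U(V₄)]} η · θ(f)`, a non-tempered Gan–Gross–Prasad period for the pair of A-parameters
  `(ρR₂ ⊕ χ₀, ρ ⊕ χ₀R₂)` — RELEVANT and SPECIAL (GGP arXiv:1911.02783 §3 definition read; Def. 31, Thm 32:
  `ord_{s=0} L(M,N,s) = ord_{s=½} L(s, ρ × χ₀^{∓1})`), so the global conjecture (period ≠ 0 for some member iff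
  `L(M,N,0) ≠ 0`) predicts ALL these periods vanish when `L(½, ρ × χ₀⁻¹) = 0`. So `C″` is no safe harbour
  either, but its failure is one conjecture deeper; a planner restating the crux as `C″` must know that the same
  pieces threaten it. What survives on paper: the crux RESTRICTED to classes orthogonal to the ε-negative (more
  cautiously: `L(½, ρ×χ₀⁻¹) = 0`) GL₂-CAP pieces — not typable today (no Hecke vocabulary in Literature) — and
  then `MiddleDegreeStep` needs CYCLES for those pieces: "higher Blasius–Rogawski cycles" already at `p = 4`
  (the route's rev-≤3 item 13662 placed the phenomenon at `p = 5`; rev 4 dropped it).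
* **F14 — the exact failure point of the expected proof.** "Rational ⟹ Tate type ⟹ `ψ ∋ χ₀` ⟹ pole of
  `L^S(s, Π × χ₀⁻¹)` at `s = 1` (Jacquet–Shalika) ⟹ theta from `dim 4` (a = 1 case of BMM Thm 72)": for
  `ψ = ρR₂ ⊞ χ₀`, `L^S(s, Π × χ₀⁻¹) = ζ_E^S(s) · L^S(s+½, ρχ₀⁻¹) · L^S(s−½, ρχ₀⁻¹)` and the pole of `ζ_E` at
  `s = 1` is CANCELLED by the zero of `L(s−½)` when `L(½, ρ×χ₀⁻¹) = 0`: no pole, no theta. Jacquet–Shalika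
  non-vanishing at `s = 1` protects only GENERIC `Ψ'`; for CAP `Ψ'` the companion value is central. (When
  `ε = +1` but `L(½) = 0` the members are coherent yet presumably still not theta lifts — Rallis inner product
  `∝ L(3/2)L(½) = 0` — a second, Rallis-dependent escape family; F12 uses only the incoherent one, which needs no
  L-value input.)
* **F15 — `m = 2` is no refuge (expected analogue, not checked to F12's depth).** On `U(6,1)` the RATIONAL
  (Tate-type) primitive `(3,3)`-classes come from parameters whose `{0}`-slot at `τ₁` is a character: besides the
  tempered shapes and `ρ⊠R₃ ⊞ χ₀` (`ρ` conjugate-orthogonal of type `(2,−2)`; here `ε_ψ ≡ 1` since `3+1` is even — all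
  members coherent, no kill) there is the GL₂-CAP shape `ψ = ρ⊠R₂ ⊞ χ₁ ⊞ χ₀ ⊞ χ₂` (`ρ` conjugate-symplectic of type
  `(5/2,−5/2)`, `χ_{±1}` conjugate-orthogonal algebraic of types `(z/z̄)^{±1}`, `χ₀` of finite order): its archimedean
  component group `⟨e_ρ, e_1, e_0, e_{−1}⟩` injects into the global one, so `A(3,3) ⊗ Π_f` is the only `H⁶`-member for
  its `Π_f` (pure `(3,3)`, rational `ℚ`-piece), and `ε_ψ(e_ρ) = ∏_{i∈{0,±1}} ε(½, ρ × χ_i⁻¹)` can be `−1`; with a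
  supercuspidal non-split place for `ρ` the same AMF-parity/dichotomy argument for the almost-equal-rank pair
  `(U(W₆^±), U(V₇))` (Gan–Ichino Thm 4.4 again) should give automorphic members with INCOHERENT dim-6 partner data,
  invisible to `SC³` (KM from split `W₆`) and to `Hdg^{2,2}·N¹ ⊆ θ(W₄) ∪ θ(W₂)` (seesaw into `W₄ ⊕ W₂`, both factors in
  BMM's range at `p = 6`). So restricting the crux to `m = 2` would not save it; recorded for the planner, to be checked
  if the route is restated that way.
* **Targets (cycle 3) — registered skeleton `Lines/conjugate-dimension-sieve.lean` (PICKED 02:12Z), six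
  stubs.** `stub_lefschetzSplit` true (hard Lefschetz for `c₁(K)`); `stub_heckeIdempotents` a construction
  (true on paper); `stub_heckeHodgeType` true (Hecke correspondences are morphisms of Hodge structures);
  `stub_sieve` true (coefficient conjugation); `stub_coreVanishing` = F5 (refutable only by `¬HC`);
  **`stub_singletonSpan` is FALSE on paper**: the projector `e_Π` of F12 is a primitive central idempotent of
  the level-`Γ` Hecke algebra of TATE TYPE (`e(P)` and all conjugates pure `(2,2)`), and `e(P) = N_ℚ⊗ℂ ∩ P ⊄
  typedSpan`. No `stub-false` PROPOSAL (the kill is modulo AMF + a datum), but the lead should not spend cycles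
  on it as stated: the true part of (T) is "COHERENT Tate type" (label product `+1` ⟺ theta-partner data
  coherent ⟺ `Π` is a theta lift from a global `W₄`, modulo the Rallis value), which lands in `SC²` (+ R1
  products, F3/F10/F11); the INCOHERENT Tate-type pieces violate the crux. Evidence note filed on the item.
-/

noncomputable section

-- The mandated namespace `Summit.<P>.<Sub>.Cruxes.…` repeats `HodgeConjecture` (single-conjunct summit).
set_option linter.dupNamespace false

namespace Summit.HodgeConjecture.HodgeConjecture.Cruxes.MiddleThetaSpan.Disproof

open Literature.AlgebraicGeometry Literature.AlgebraicGeometry.HodgeTheory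
  Literature.AlgebraicGeometry.ShimuraVarieties Literature.AlgebraicTopology.SingularHomology
open Summit.HodgeConjecture.HodgeConjecture.Theses.EndoscopicMiddleDegree (MiddleThetaSpan)

variable {p : ℕ} {X : Motives.SchemeOver ℂ}

/-! ### Vocabulary: the inlined special-cycle span and its support-widening -/

/-- `SC D k`: the route file's inlined rendering of `specialCycleClasses D k` (complex span of the
classes supported on the special cycles `c(W)`, `W` totally positive definite of dimension `k`).
[cite: BergeronMillsonMoeglin2016Balls, Introduction §1.7] -/
abbrev SC (D : UnitaryBallQuotientDatum p X) (k : ℕ) : Submodule ℂ (complexBetti X (2 * k)) :=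
  ⨆ (W : Submodule D.E (Fin (p + 1) → D.E)) (_ : IsTotallyPositive (conjRingHom D.E) D.H W)
    (_ : Module.finrank D.E W = k), classesSupportedOn X (D.specialSubvariety W) (2 * k)

/-- `SCsupp D k j`: ALL classes of degree `j` supported on some special cycle `c(W)` of codimension
`k` — for `j = 2(k+1)` these are the Gysin images `ι_*H²(c̃(W))`, the shape in which the theta
mechanism delivers middle-degree classes at a fixed level (finding F3). [folklore] -/
abbrev SCsupp (D : UnitaryBallQuotientDatum p X) (k j : ℕ) : Submodule ℂ (complexBetti X j) :=
  ⨆ (W : Submodule D.E (Fin (p + 1) → D.E)) (_ : IsTotallyPositive (conjRingHom D.E) D.H W)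
    (_ : Module.finrank D.E W = k), classesSupportedOn X (D.specialSubvariety W) j

/-- The inlined span is literally `specialCycleClasses` (the cone-repair rendering is `rfl`).
[cite: BergeronMillsonMoeglin2016Balls, Introduction §1.7] -/
theorem sc_eq (D : UnitaryBallQuotientDatum p X) (k : ℕ) : SC D k = specialCycleClasses D k := rfl

/-- `SC D k` is the degree-`2k` instance of `SCsupp`. [folklore] -/
theorem sc_eq_scSupp (D : UnitaryBallQuotientDatum p X) (k : ℕ) : SC D k = SCsupp D k (2 * k) := rfl

/-! ### Cup products keep supports (one factor arbitrary) -/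

/-- A class supported on a Zariski-closed `Z`, cupped with ANY class, stays supported on `Z`
(`H_Z ∪ H = H_{Z ∩ X} = H_Z`; Fulton §19.2). [cite: Fulton1998, §19.2 Cor. 19.2] -/
theorem cup_mem_classesSupportedOn_left {Z : Set X.left} (hZ : IsClosed Z) {i j n : ℕ}
    (h : i + j = n) {s : complexBetti X i} (hs : s ∈ classesSupportedOn X Z i)
    (d : complexBetti X j) : cupProduct h s d ∈ classesSupportedOn X Z n := by
  have hd : d ∈ classesSupportedOn X Set.univ j := by
    rw [classesSupportedOn_univ]; exact Submodule.mem_top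
  simpa only [Set.inter_univ] using cupProduct_mem_classesSupportedOn_inter hZ isClosed_univ h hs hd

/-- Symmetric version: any class cupped with a class supported on `Z` is supported on `Z`.
[cite: Fulton1998, §19.2 Cor. 19.2] -/
theorem cup_mem_classesSupportedOn_right {Z : Set X.left} (hZ : IsClosed Z) {i j n : ℕ}
    (h : i + j = n) (s : complexBetti X i) {d : complexBetti X j}
    (hd : d ∈ classesSupportedOn X Z j) : cupProduct h s d ∈ classesSupportedOn X Z n := by
  have hs : s ∈ classesSupportedOn X Set.univ i := by
    rw [classesSupportedOn_univ]; exact Submodule.mem_top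
  simpa only [Set.univ_inter] using cupProduct_mem_classesSupportedOn_inter isClosed_univ hZ h hs hd

/-- Any class cupped with a class supported in codimension `≥ r` is supported in codimension `≥ r`
(`H ∪ NʳH ⊆ Nʳ`; in particular `H⁰ ∪ N¹H² ⊆ N¹H²`). [cite: GrothendieckTopology1969, §1] -/
theorem cup_mem_supportedClasses_right {i j n : ℕ} (h : i + j = n) (s : complexBetti X i)
    {r : ℕ} {d : complexBetti X j} (hd : d ∈ supportedClasses X j r) :
    cupProduct h s d ∈ supportedClasses X n r := by
  have key : supportedClasses X j r ≤ (supportedClasses X n r).comap (cupProduct h s) :=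
    supportedClasses_le fun Z hZ hr d hd ↦ by
      rw [Submodule.mem_comap]
      exact classesSupportedOn_le_supportedClasses hZ hr n
        (cup_mem_classesSupportedOn_right hZ h s (mem_classesSupportedOn_iff.mpr
          (LinearMap.mem_ker.mp hd)))
  exact key hd

/-! ### F3: summand 2 of the crux sits inside the support-widening `SCsupp` -/

/-- **Summand 2 ≤ SCsupp.** Every `s ∪ d` with `s` a codimension-`m` special cycle class and `d`
any degree-2 class (a fortiori `d ∈ N¹H²`) is supported on a codimension-`m` special cycle.
The converse inclusion is exactly what fails for the mechanism's fixed-level output (F3).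
[cite: BergeronMillsonMoeglin2016Balls, Part 2 Thm 71 (p. 39) and its proof (p. 40)] -/
theorem spanCup_le_scSupp (m : ℕ) (D : UnitaryBallQuotientDatum (2 * (m + 1)) X) :
    Submodule.span ℂ {z : complexBetti X (2 * (m + 1)) |
        ∃ s ∈ SC D m, ∃ d ∈ algebraicClasses X 1,
          z = cupProduct (two_mul_add_two_mul m 1) s d} ≤ SCsupp D m (2 * (m + 1)) := by
  refine Submodule.span_le.2 ?_
  rintro z ⟨s, hs, d, -, rfl⟩
  have key : SC D m ≤ (SCsupp D m (2 * (m + 1))).comap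
      ((cupProduct (two_mul_add_two_mul m 1)).flip d) := by
    refine iSup_le fun W ↦ iSup_le fun hW ↦ iSup_le fun hk ↦ fun s hs ↦ ?_
    rw [Submodule.mem_comap, LinearMap.flip_apply]
    exact Submodule.mem_iSup_of_mem W (Submodule.mem_iSup_of_mem hW (Submodule.mem_iSup_of_mem hk
      (cup_mem_classesSupportedOn_left (D.isClosed_specialSubvariety W hW) _ hs d)))
  simpa using key hs

/-- **The repaired statement `C′` (candidate, F3):** as the crux, but summand 2 widened from
`SC^m · N¹H²` to ALL middle-degree classes supported on codimension-`m` special cycles. This is the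
shape BMM's tower-level Thm 71 actually yields at a fixed level (`e_K` of products with a special
factor is supported on special cycles but is not a product at level `K`). Glue to the target then
needs "rational `(k,k)`-classes of coniveau `≥ k-1` are algebraic" (Lefschetz (1,1) on a
resolution + Deligne MHS) instead of only `CupProductAlgebraic`. [cite: BergeronMillsonMoeglin2016Balls, Part 2 Thm 71] -/
def MiddleThetaSpanWidened : Prop :=
  ∀ (m : ℕ) (X : Motives.SchemeOver ℂ) (D : UnitaryBallQuotientDatum (2 * (m + 1)) X),
    1 ≤ m → m ≤ 2 → ∀ c : complexBetti X (2 * (m + 1)), IsRationalClass c →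
      IsOfHodgeType (2 * (m + 1)) X (2 * (m + 1)) (m + 1) (m + 1) c →
        c ∈ SC D (m + 1) ⊔ SCsupp D m (2 * (m + 1)) ⊔
          Submodule.span ℂ {z : complexBetti X (2 * (m + 1)) |
            ∃ a : complexBetti X (2 * m), IsRationalClass a ∧
              IsOfHodgeType (2 * (m + 1)) X (2 * m) m m a ∧
                ∃ d ∈ algebraicClasses X 1, z = cupProduct (two_mul_add_two_mul m 1) a d}

/-- **`MiddleThetaSpan → C′`**: the typed crux implies its support-widening, so `C′` is the weaker
(safer) rendering; a fixed-level counterexample to the crux lying in `SCsupp` would classify the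
crux `refuted-misstated` with repair `C′`. [cite: BergeronMillsonMoeglin2016Balls, Part 2 Thm 71] -/
theorem widened_of_middleThetaSpan (h : MiddleThetaSpan) : MiddleThetaSpanWidened := by
  intro m X D hm1 hm2 c hc hH
  have hc' := h m X D hm1 hm2 c hc hH
  exact sup_le_sup (sup_le_sup le_rfl (spanCup_le_scSupp m D)) le_rfl hc'


/-! ### F3 (repair): `C″` — cycles ON special cycles; glue to the target proved -/

/-- Summand 2 of the recommended repair: classes of degree `j` supported on a Zariski-closed subset of
codimension `≥ k+1` lying on a codimension-`k` special cycle ("codimension-`(k+1)` cycles on special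
cycles": the fixed-level shape of `e_K([Z'] ∪ h')`, finding F3). [cite: BergeronMillsonMoeglin2016Balls, Introduction Remark 3 (p. 3) and Part 2 Thm 71] -/
abbrev SConSpecial (D : UnitaryBallQuotientDatum p X) (k j : ℕ) : Submodule ℂ (complexBetti X j) :=
  ⨆ (W : Submodule D.E (Fin (p + 1) → D.E)) (_ : IsTotallyPositive (conjRingHom D.E) D.H W)
    (_ : Module.finrank D.E W = k) (Z : Set X.left) (_ : IsClosed Z) (_ : Z ⊆ D.specialSubvariety W)
    (_ : ∀ z ∈ Z, ((k + 1 : ℕ) : ℕ∞) ≤ Order.coheight z), classesSupportedOn X Z j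

/-- `SConSpecial` in degree `2(k+1)` consists of algebraic classes of codimension `k+1` — by definition
of `N^{k+1}`, no moving lemma. [cite: GrothendieckTopology1969, §1] -/
theorem scOnSpecial_le_algebraicClasses (D : UnitaryBallQuotientDatum p X) (k : ℕ) :
    SConSpecial D k (2 * (k + 1)) ≤ algebraicClasses X (k + 1) :=
  iSup_le fun _ ↦ iSup_le fun _ ↦ iSup_le fun _ ↦ iSup_le fun _ ↦ iSup_le fun hZ ↦ iSup_le fun _ ↦
    iSup_le fun hk ↦ classesSupportedOn_le_supportedClasses hZ hk _

/-- `SConSpecial ≤ SCsupp` (a class supported on `Z ⊆ c(W)` is supported on `c(W)`), so `C″` sits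
between the crux's product summand (on paper) and `C′`. [cite: GrothendieckTopology1969, §1] -/
theorem scOnSpecial_le_scSupp (D : UnitaryBallQuotientDatum p X) (k j : ℕ) :
    SConSpecial D k j ≤ SCsupp D k j :=
  iSup_le fun W ↦ iSup_le fun hW ↦ iSup_le fun hk ↦ iSup_le fun _ ↦ iSup_le fun _ ↦ iSup_le fun hZW ↦
    iSup_le fun _ ↦ le_iSup_of_le W (le_iSup_of_le hW (le_iSup_of_le hk (classesSupportedOn_mono hZW j)))

/-- **The recommended repaired crux `C″`** ("rational middle Hodge classes are special cycles, cycles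
on special cycles one codimension up, or Lefschetz"): R1-proof rendering of the same mechanism.
[cite: BergeronMillsonMoeglin2016Balls, Introduction Remark 3 and Part 2 Thm 71] -/
def MiddleThetaSpanOnSpecial : Prop :=
  ∀ (m : ℕ) (X : Motives.SchemeOver ℂ) (D : UnitaryBallQuotientDatum (2 * (m + 1)) X),
    1 ≤ m → m ≤ 2 → ∀ c : complexBetti X (2 * (m + 1)), IsRationalClass c →
      IsOfHodgeType (2 * (m + 1)) X (2 * (m + 1)) (m + 1) (m + 1) c →
        c ∈ SC D (m + 1) ⊔ SConSpecial D m (2 * (m + 1)) ⊔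
          Submodule.span ℂ {z : complexBetti X (2 * (m + 1)) |
            ∃ a : complexBetti X (2 * m), IsRationalClass a ∧
              IsOfHodgeType (2 * (m + 1)) X (2 * m) m m a ∧
                ∃ d ∈ algebraicClasses X 1, z = cupProduct (two_mul_add_two_mul m 1) a d}

open Summit.HodgeConjecture.HodgeConjecture.Theses.EndoscopicMiddleDegree (MiddleDegreeStep
  CupProductAlgebraic) in
/-- **Glue for `C″` (the analogue of the route's `ThetaStep`, PROVED):**
`CupProductAlgebraic → C″ → MiddleDegreeStep`. Summand 1 is algebraic (`specialCycleClasses ≤ N`),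
summand 2 by `scOnSpecial_le_algebraicClasses`, summand 3 by the target's hypothesis (HC in degree
`2m`) and `CupProductAlgebraic`. So switching the crux to `C″` costs the route nothing.
[cite: BergeronMillsonMoeglin2016Balls, Introduction §1.3] -/
theorem middleDegreeStep_of_onSpecial (hcup : CupProductAlgebraic) (h : MiddleThetaSpanOnSpecial) :
    MiddleDegreeStep := by
  intro m X hm1 hm2 hD hlow c hc hH
  obtain ⟨D⟩ := hD
  obtain ⟨y, hy, w, hw, rfl⟩ := Submodule.mem_sup.1 (h m X D hm1 hm2 c hc hH)
  obtain ⟨u, hu, v, hv, rfl⟩ := Submodule.mem_sup.1 hy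
  refine add_mem (add_mem ?_ (scOnSpecial_le_algebraicClasses D m hv)) ?_
  · rw [sc_eq] at hu; exact specialCycleClasses_le_algebraicClasses D (m + 1) hu
  · refine (Submodule.span_le.2 ?_) hw
    rintro z ⟨a, ha, haH, d, hd, rfl⟩
    exact hcup D.isSmoothProjective m 1 a d (hlow a ha haH) hd

/-! ### F4: the `m = 0` calibration — the sentence at `m = 0` is Lefschetz (1,1) -/

/-- The crux's sentence at `m = 0` (compact Picard modular surfaces, `p = 2`), guard removed.
[cite: BergeronMillsonMoeglin2016Balls, Introduction §1.7] -/
def AtZero : Prop :=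
  ∀ (X : Motives.SchemeOver ℂ) (D : UnitaryBallQuotientDatum (2 * (0 + 1)) X)
    (c : complexBetti X (2 * (0 + 1))), IsRationalClass c →
      IsOfHodgeType (2 * (0 + 1)) X (2 * (0 + 1)) (0 + 1) (0 + 1) c →
        c ∈ SC D (0 + 1) ⊔
          Submodule.span ℂ {z : complexBetti X (2 * (0 + 1)) |
            ∃ s ∈ SC D 0, ∃ d ∈ algebraicClasses X 1,
              z = cupProduct (two_mul_add_two_mul 0 1) s d} ⊔
          Submodule.span ℂ {z : complexBetti X (2 * (0 + 1)) |
            ∃ a : complexBetti X (2 * 0), IsRationalClass a ∧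
              IsOfHodgeType (2 * (0 + 1)) X (2 * 0) 0 0 a ∧
                ∃ d ∈ algebraicClasses X 1, z = cupProduct (two_mul_add_two_mul 0 1) a d}

/-- Lefschetz `(1,1)` for the compact arithmetic 2-ball quotients (as a hypothesis shape: rational
`(1,1)`-classes are algebraic). [cite: VoisinHodgeI2002, Thm. 11.30] -/
def LefschetzOneOneOnTwoBallQuotients : Prop :=
  ∀ (X : Motives.SchemeOver ℂ), Nonempty (UnitaryBallQuotientDatum (2 * (0 + 1)) X) →
    ∀ c : complexBetti X (2 * 1), IsRationalClass c → IsOfHodgeType (2 * (0 + 1)) X (2 * 1) 1 1 c →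
      c ∈ algebraicClasses X 1

/-- `SC⁰ = H⁰` (the special subvariety of `W = 0` is everything).
[cite: BergeronMillsonMoeglin2016Balls, Part 2 §3.5] -/
theorem sc_zero (D : UnitaryBallQuotientDatum p X) : SC D 0 = ⊤ := by
  rw [sc_eq]; exact specialCycleClasses_zero D

/-- **F4 (⇐)**: Lefschetz (1,1) gives the `m = 0` sentence — `c = 1 ∪ c` with `1 ∈ SC⁰ = H⁰`, so
summand 2 alone contains every algebraic divisor class. [cite: Hatcher2002, §3.2 p. 211] -/
theorem atZero_of_lefschetz (hL : LefschetzOneOneOnTwoBallQuotients) : AtZero := by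
  intro X D c hc hH
  have hca : c ∈ algebraicClasses X 1 := hL X ⟨D⟩ c hc hH
  refine Submodule.mem_sup_left (Submodule.mem_sup_right (Submodule.subset_span ?_))
  refine ⟨singularCohomology.one ℂ (Motives.ComplexPoints X), ?_, c, hca, ?_⟩
  · rw [sc_zero]; exact Submodule.mem_top
  · exact (one_cupProduct c).symm

/-- **F4 (⇒)**: conversely the `m = 0` sentence gives Lefschetz (1,1) on these surfaces, because all
three summands consist of algebraic classes UNCONDITIONALLY in this degree (`SC¹ ≤ N¹`; `H⁰ ∪ N¹ ⊆ N¹`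
needs no moving lemma). So at `m = 0` the crux has no theta content at all. [cite: Fulton1998, §19.2] -/
theorem lefschetz_of_atZero (h0 : AtZero) : LefschetzOneOneOnTwoBallQuotients := by
  rintro X ⟨D⟩ c hc hH
  obtain ⟨y, hy, w, hw, rfl⟩ := Submodule.mem_sup.1 (h0 X D c hc hH)
  obtain ⟨u, hu, v, hv, rfl⟩ := Submodule.mem_sup.1 hy
  refine add_mem (add_mem ?_ ?_) ?_
  · rw [sc_eq] at hu; exact specialCycleClasses_le_algebraicClasses D (0 + 1) hu
  · refine (Submodule.span_le.2 ?_) hv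
    rintro z ⟨s, -, d, hd, rfl⟩
    exact cup_mem_supportedClasses_right _ s hd
  · refine (Submodule.span_le.2 ?_) hw
    rintro z ⟨a, -, -, d, hd, rfl⟩
    exact cup_mem_supportedClasses_right _ a hd

/-- **F4**: at `m = 0` the crux's sentence is EQUIVALENT to Lefschetz (1,1) on compact arithmetic
2-ball quotients. [cite: VoisinHodgeI2002, Thm. 11.30] -/
theorem atZero_iff_lefschetz : AtZero ↔ LefschetzOneOneOnTwoBallQuotients :=
  ⟨lefschetz_of_atZero, atZero_of_lefschetz⟩

/-! ### F6: natural strengthenings (recorded; not refutable without a datum) -/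

/-- Strengthening: drop `IsRationalClass` — ALL `(m+1,m+1)`-classes in the span. BMM's "if `a = b`
this is no longer true" (arXiv:1306.1515 p. 5) is about `SC^{2a}` alone and is cured by the `H^{1,1}`
factor in print, so it does not refute this either; status unknown. [cite: BergeronMillsonMoeglin2016Balls, Introduction Thm 4] -/
def MiddleThetaSpanAllHodge : Prop :=
  ∀ (m : ℕ) (X : Motives.SchemeOver ℂ) (D : UnitaryBallQuotientDatum (2 * (m + 1)) X),
    1 ≤ m → m ≤ 2 → ∀ c : complexBetti X (2 * (m + 1)),
      IsOfHodgeType (2 * (m + 1)) X (2 * (m + 1)) (m + 1) (m + 1) c →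
        c ∈ SC D (m + 1) ⊔
          Submodule.span ℂ {z : complexBetti X (2 * (m + 1)) |
            ∃ s ∈ SC D m, ∃ d ∈ algebraicClasses X 1,
              z = cupProduct (two_mul_add_two_mul m 1) s d} ⊔
          Submodule.span ℂ {z : complexBetti X (2 * (m + 1)) |
            ∃ a : complexBetti X (2 * m), IsRationalClass a ∧
              IsOfHodgeType (2 * (m + 1)) X (2 * m) m m a ∧
                ∃ d ∈ algebraicClasses X 1, z = cupProduct (two_mul_add_two_mul m 1) a d}

/-- The all-Hodge strengthening implies the crux (any proof avoiding rationality proves more than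
is believed; rationality is load-bearing in the expected proof: rational ⟹ Tate-type packet).
[cite: BergeronMillsonMoeglin2016Balls, Introduction Thm 4] -/
theorem middleThetaSpan_of_allHodge (h : MiddleThetaSpanAllHodge) : MiddleThetaSpan :=
  fun m X D hm1 hm2 c _ hH ↦ h m X D hm1 hm2 c hH


/-! ## Cycle 2 (2026-08-16): F6′, F8, F9, F10 and the Targets pre-read -/

/-! ### F9: summand 2 is decorative — the crux is a TWO-summand statement
(modulo the textbook fact that special cycle classes have diagonal Hodge type) -/

section TwoSummands

/-- Summand 2 / summand 3 as spans of bilinear images (`Submodule.map₂` of the cup product): the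
route file's set-builder rendering `{z | ∃ s ∈ S, ∃ d ∈ N¹, z = s ∪ d}` is `map₂ (∪) S N¹`. [folklore] -/
theorem span_cup_eq_map₂ {i j n : ℕ} (h : i + j = n) (S : Submodule ℂ (complexBetti X i))
    (T : Submodule ℂ (complexBetti X j)) :
    Submodule.span ℂ {z : complexBetti X n | ∃ s ∈ S, ∃ d ∈ T, z = cupProduct h s d} =
      Submodule.map₂ (cupProduct h) S T := by
  rw [Submodule.map₂_eq_span_image2]
  congr 1
  ext z
  simp only [Set.mem_setOf_eq, Set.mem_image2, SetLike.mem_coe]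
  constructor
  · rintro ⟨s, hs, d, hd, rfl⟩; exact ⟨s, hs, d, hd, rfl⟩
  · rintro ⟨s, hs, d, hd, rfl⟩; exact ⟨s, hs, d, hd, rfl⟩

/-- Same for summand 3, whose first factor ranges over a SET (the rational `(m,m)`-classes): the span
is `map₂ (∪) (span of that set) N¹`. [folklore] -/
theorem span_cup_eq_map₂_span {i j n : ℕ} (h : i + j = n) (A : Set (complexBetti X i))
    (T : Submodule ℂ (complexBetti X j)) :
    Submodule.span ℂ {z : complexBetti X n | ∃ a : complexBetti X i, a ∈ A ∧ ∃ d ∈ T,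
        z = cupProduct h a d} = Submodule.map₂ (cupProduct h) (Submodule.span ℂ A) T := by
  conv_rhs => rw [← Submodule.span_eq T]
  rw [Submodule.map₂_span_span]
  congr 1
  ext z
  simp only [Set.mem_setOf_eq, Set.mem_image2, SetLike.mem_coe]
  constructor
  · rintro ⟨s, hs, d, hd, rfl⟩; exact ⟨s, hs, d, hd, rfl⟩
  · rintro ⟨s, hs, d, hd, rfl⟩; exact ⟨s, hs, d, hd, rfl⟩

/-- The `ℂ`-span of the RATIONAL classes of Hodge type `(a,a)` in degree `k` (ambient dimension `n`):
`Hdg^{a,a}_ℚ ⊗ ℂ`. [cite: Deligne2000, §1] -/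
abbrev ratHodgeSpan (n : ℕ) (X : Motives.SchemeOver ℂ) (k a : ℕ) : Submodule ℂ (complexBetti X k) :=
  Submodule.span ℂ {c : complexBetti X k | IsRationalClass c ∧ IsOfHodgeType n X k a a c}

/-- HYPOTHESIS SHAPE (textbook; Voisin I Prop. 11.20 / Kudla–Millson): the rational special cycle
classes of codimension `m` on a `2(m+1)`-ball quotient are of Hodge type `(m,m)`. In the tree this is
`isOfHodgeType_complexGysin` modulo `hodgePQ_independent_of_hodgeModel`; kept as an explicit hypothesis
here so that nothing below is conditional by stealth. [cite: VoisinHodgeI2002, Prop. 11.20] -/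
def SpecialClassesDiagonal : Prop :=
  ∀ (m : ℕ) (X : Motives.SchemeOver ℂ) (D : UnitaryBallQuotientDatum (2 * (m + 1)) X),
    ∀ c ∈ SC D m, IsRationalClass c → IsOfHodgeType (2 * (m + 1)) X (2 * m) m m c

/-- Under `SpecialClassesDiagonal`, `SC^m ≤ Hdg^{m,m}_ℚ ⊗ ℂ` (`SC` is the complex span of its rational
classes, `specialCycleClasses_eq_span_isRationalClass`). [cite: BergeronMillsonMoeglin2016Balls, Part 2 §3.5] -/
theorem sc_le_ratHodgeSpan (hdiag : SpecialClassesDiagonal) (m : ℕ)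
    (D : UnitaryBallQuotientDatum (2 * (m + 1)) X) :
    SC D m ≤ ratHodgeSpan (2 * (m + 1)) X (2 * m) m := by
  rw [sc_eq]
  refine (specialCycleClasses_le_span_isRationalClass D m).trans (Submodule.span_mono ?_)
  rintro c ⟨hc, hcS⟩
  exact ⟨hc, hdiag m X D c hcS hc⟩

/-- **The two-summand form of the crux**: `Hdg^{m+1,m+1}_ℚ ⊆ SC^{m+1} ⊔ Hdg^{m,m}_ℚ · N¹`.
[cite: BergeronMillsonMoeglin2016Balls, Introduction Thm 4 and Remark 3] -/
def MiddleThetaSpanTwoSummands : Prop :=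
  ∀ (m : ℕ) (X : Motives.SchemeOver ℂ) (D : UnitaryBallQuotientDatum (2 * (m + 1)) X),
    1 ≤ m → m ≤ 2 → ∀ c : complexBetti X (2 * (m + 1)), IsRationalClass c →
      IsOfHodgeType (2 * (m + 1)) X (2 * (m + 1)) (m + 1) (m + 1) c →
        c ∈ SC D (m + 1) ⊔
          Submodule.span ℂ {z : complexBetti X (2 * (m + 1)) |
            ∃ a : complexBetti X (2 * m), IsRationalClass a ∧
              IsOfHodgeType (2 * (m + 1)) X (2 * m) m m a ∧
                ∃ d ∈ algebraicClasses X 1, z = cupProduct (two_mul_add_two_mul m 1) a d}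

/-- The two-summand form trivially implies the crux (it drops a summand). [folklore] -/
theorem middleThetaSpan_of_twoSummands (h : MiddleThetaSpanTwoSummands) : MiddleThetaSpan := by
  intro m X D hm1 hm2 c hc hH
  obtain ⟨u, hu, w, hw, rfl⟩ := Submodule.mem_sup.1 (h m X D hm1 hm2 c hc hH)
  exact Submodule.add_mem _ (Submodule.mem_sup_left (Submodule.mem_sup_left hu))
    (Submodule.mem_sup_right hw)

/-- **F9.** Conversely, modulo `SpecialClassesDiagonal` summand 2 (`SC^m · N¹`) sits inside summand 3
(`Hdg^{m,m}_ℚ · N¹`), so the crux IS the two-summand statement: provers may ignore summand 2, refuters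
need only beat `SC^{m+1} ⊔ Hdg^{m,m}_ℚ·N¹`. [cite: BergeronMillsonMoeglin2016Balls, Introduction Remark 3] -/
theorem twoSummands_of_middleThetaSpan (hdiag : SpecialClassesDiagonal) (h : MiddleThetaSpan) :
    MiddleThetaSpanTwoSummands := by
  intro m X D hm1 hm2 c hc hH
  have hc' := h m X D hm1 hm2 c hc hH
  have key : Submodule.span ℂ {z : complexBetti X (2 * (m + 1)) |
      ∃ s ∈ SC D m, ∃ d ∈ algebraicClasses X 1, z = cupProduct (two_mul_add_two_mul m 1) s d} ≤
      Submodule.span ℂ {z : complexBetti X (2 * (m + 1)) |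
        ∃ a : complexBetti X (2 * m), IsRationalClass a ∧
          IsOfHodgeType (2 * (m + 1)) X (2 * m) m m a ∧
            ∃ d ∈ algebraicClasses X 1, z = cupProduct (two_mul_add_two_mul m 1) a d} := by
    have h3 : Submodule.span ℂ {z : complexBetti X (2 * (m + 1)) |
        ∃ a : complexBetti X (2 * m), IsRationalClass a ∧
          IsOfHodgeType (2 * (m + 1)) X (2 * m) m m a ∧
            ∃ d ∈ algebraicClasses X 1, z = cupProduct (two_mul_add_two_mul m 1) a d} =
        Submodule.map₂ (cupProduct (two_mul_add_two_mul m 1))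
          (ratHodgeSpan (2 * (m + 1)) X (2 * m) m) (algebraicClasses X 1) := by
      rw [← span_cup_eq_map₂_span]
      congr; ext z; simp only [Set.mem_setOf_eq, and_assoc]
    rw [span_cup_eq_map₂, h3]
    exact Submodule.map₂_le_map₂ (sc_le_ratHodgeSpan hdiag m D) le_rfl
  obtain ⟨y, hy, w, hw, rfl⟩ := Submodule.mem_sup.1 hc'
  obtain ⟨u, hu, v, hv, rfl⟩ := Submodule.mem_sup.1 hy
  exact Submodule.add_mem _ (Submodule.add_mem _ (Submodule.mem_sup_left hu)
    (Submodule.mem_sup_right (key hv))) (Submodule.mem_sup_right hw)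

/-- **F9 (iff).** [cite: BergeronMillsonMoeglin2016Balls, Introduction Remark 3] -/
theorem middleThetaSpan_iff_twoSummands (hdiag : SpecialClassesDiagonal) :
    MiddleThetaSpan ↔ MiddleThetaSpanTwoSummands :=
  ⟨twoSummands_of_middleThetaSpan hdiag, middleThetaSpan_of_twoSummands⟩

end TwoSummands

/-! ### F8: the numerical shadow of the crux (rank inequality for every functional killing `SC^{m+1}`) -/

section RankBound

universe u v in
open scoped TensorProduct in
/-- Rank of the span of a bilinear image is at most the product of the ranks (through the tensor
product). [folklore] -/
theorem rank_map₂_le {K : Type u} [Field K] {M N P : Type v} [AddCommGroup M] [Module K M]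
    [AddCommGroup N] [Module K N] [AddCommGroup P] [Module K P]
    (f : M →ₗ[K] N →ₗ[K] P) (p : Submodule K M) (q : Submodule K N) :
    Module.rank K (Submodule.map₂ f p q) ≤ Module.rank K p * Module.rank K q := by
  let g : p ⊗[K] q →ₗ[K] P := TensorProduct.lift (f.domRestrict₁₂ p q)
  have hle : Submodule.map₂ f p q ≤ LinearMap.range g := by
    refine Submodule.map₂_le.2 fun m hm n hn ↦ ⟨⟨m, hm⟩ ⊗ₜ ⟨n, hn⟩, ?_⟩
    simp [g, LinearMap.domRestrict₁₂_apply]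
  calc Module.rank K (Submodule.map₂ f p q) ≤ Module.rank K (LinearMap.range g) :=
        Submodule.rank_mono hle
    _ ≤ Module.rank K (p ⊗[K] q) := rank_range_le g
    _ = Module.rank K p * Module.rank K q := rank_tensorProduct' ..

/-- **F8 — the rank inequality forced by the crux.** For every datum and every endomorphism `e` of
`H^{2n}(X(ℂ); ℂ)` that kills the special `n`-cycle classes (intended: the Hecke projector onto the sum
`Π_T` of the Tate-type `A(n,n)`-pieces whose theta-dichotomy space `W_{2n}` is NOT split — on those
`SCⁿ_K` projects to zero, F3 (iii)), the image of `Hdg^{n,n}_ℚ ⊗ ℂ` under `e` has rank at most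
`rk SC^{n-1} · rk N¹ + rk Hdg^{n-1,n-1}_ℚ · rk N¹`, hence at most `2 · h^{n-1,n-1} · h^{1,1}`-ish. A level
`K` with `dim Π_T(K) >` that bound refutes the crux (class: misstated, repair `C″`). WHY IT DOES NOT BITE
asymptotically (`m = 1`, full-level towers `K(𝔫)`): Marshall–Shin (arXiv:1804.05047, Thm 1.2 p. 3, cond.
on KMSW) give `h²(X(𝔫)) ≪ N𝔫^{11}` with the shape `(3,1),(1,2)` — the `A(1,1)` classes — expected SHARP,
so the right side is `≍ N𝔫^{22}`, while their Prop. "singlefinite" + Savin bound the whole Tate-type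
shape `(1,4),(1,1)` by `N𝔫^{dim GL₅/P_{(4,1)} + 16 + 1 + ε} = N𝔫^{21+ε}`: products of divisor classes
OUTNUMBER all Tate-type `(2,2)`-classes by a power of the level. The count is therefore inconclusive
and R1 must be decided by the local/period analysis of F3 (iii). [cite: MarshallShin2019EndoscopyCohomologyUn1, Theorem 1.2] -/
theorem rank_map_ratHodgeSpan_le_of_middleThetaSpan (h : MiddleThetaSpan) {m : ℕ}
    (D : UnitaryBallQuotientDatum (2 * (m + 1)) X) (hm1 : 1 ≤ m) (hm2 : m ≤ 2)
    (e : complexBetti X (2 * (m + 1)) →ₗ[ℂ] complexBetti X (2 * (m + 1)))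
    (he : SC D (m + 1) ≤ LinearMap.ker e) :
    Module.rank ℂ ((ratHodgeSpan (2 * (m + 1)) X (2 * (m + 1)) (m + 1)).map e) ≤
      Module.rank ℂ (SC D m) * Module.rank ℂ (algebraicClasses X 1) +
        Module.rank ℂ (ratHodgeSpan (2 * (m + 1)) X (2 * m) m) *
          Module.rank ℂ (algebraicClasses X 1) := by
  -- the three summands, as submodules
  set S₁ := SC D (m + 1) with hS₁
  set S₂ := Submodule.map₂ (cupProduct (two_mul_add_two_mul m 1)) (SC D m) (algebraicClasses X 1)
    with hS₂
  set S₃ := Submodule.map₂ (cupProduct (two_mul_add_two_mul m 1))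
    (ratHodgeSpan (2 * (m + 1)) X (2 * m) m) (algebraicClasses X 1) with hS₃
  have hle : ratHodgeSpan (2 * (m + 1)) X (2 * (m + 1)) (m + 1) ≤ S₁ ⊔ S₂ ⊔ S₃ := by
    refine Submodule.span_le.2 ?_
    rintro c ⟨hc, hH⟩
    have hc' := h m X D hm1 hm2 c hc hH
    have e2 : Submodule.span ℂ {z : complexBetti X (2 * (m + 1)) |
        ∃ s ∈ SC D m, ∃ d ∈ algebraicClasses X 1,
          z = cupProduct (two_mul_add_two_mul m 1) s d} = S₂ := span_cup_eq_map₂ _ _ _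
    have e3 : Submodule.span ℂ {z : complexBetti X (2 * (m + 1)) |
        ∃ a : complexBetti X (2 * m), IsRationalClass a ∧
          IsOfHodgeType (2 * (m + 1)) X (2 * m) m m a ∧
            ∃ d ∈ algebraicClasses X 1, z = cupProduct (two_mul_add_two_mul m 1) a d} = S₃ := by
      rw [hS₃, ← span_cup_eq_map₂_span]
      congr; ext z; simp only [Set.mem_setOf_eq, and_assoc]
    rw [e2, e3] at hc'
    exact hc'
  have hmap : (ratHodgeSpan (2 * (m + 1)) X (2 * (m + 1)) (m + 1)).map e ≤ S₂.map e ⊔ S₃.map e := by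
    refine (Submodule.map_mono hle).trans ?_
    rw [Submodule.map_sup, Submodule.map_sup]
    have h1 : S₁.map e = ⊥ := by
      rw [eq_bot_iff, Submodule.map_le_iff_le_comap]
      exact he
    rw [h1, bot_sup_eq]
  calc Module.rank ℂ ((ratHodgeSpan (2 * (m + 1)) X (2 * (m + 1)) (m + 1)).map e)
      ≤ Module.rank ℂ ↥(S₂.map e ⊔ S₃.map e) := Submodule.rank_mono hmap
    _ ≤ Module.rank ℂ (S₂.map e) + Module.rank ℂ (S₃.map e) :=
        Submodule.rank_add_le_rank_add_rank _ _
    _ ≤ Module.rank ℂ S₂ + Module.rank ℂ S₃ := add_le_add (rank_map_le e S₂) (rank_map_le e S₃)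
    _ ≤ _ := add_le_add (rank_map₂_le _ _ _) (rank_map₂_le _ _ _)


/-! ### F11: the `m = 1` sharpening — products of two `T`-split divisor classes are invisible -/

universe u v in
/-- Shape lemma for F11: if `R ⊆ S₁ ⊔ map₂ f N N` with `N ≤ Pₛ ⊔ D₂`, `f` symmetric, and `e` kills
`S₁` and `map₂ f Pₛ Pₛ`, then `rk e(span R) ≤ rk (Pₛ ⊔ D₂) · rk D₂`. [folklore] -/
theorem rank_map_span_le_of_symm_of_kills_sq {K : Type u} [Field K] {M P : Type v} [AddCommGroup M]
    [Module K M] [AddCommGroup P] [Module K P]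
    (f : M →ₗ[K] M →ₗ[K] P) (hf : ∀ a b : M, f a b = f b a) (S₁ : Submodule K P)
    (N Pₛ D₂ : Submodule K M) (hN : N ≤ Pₛ ⊔ D₂) (R : Set P)
    (hR : R ⊆ ↑(S₁ ⊔ Submodule.map₂ f N N))
    (e : P →ₗ[K] P) (he₁ : S₁ ≤ LinearMap.ker e) (he₂ : Submodule.map₂ f Pₛ Pₛ ≤ LinearMap.ker e) :
    Module.rank K ((Submodule.span K R).map e) ≤ Module.rank K ↥(Pₛ ⊔ D₂) * Module.rank K D₂ := by
  have hflip : f.flip = f := by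
    ext a b; exact (hf a b).symm
  have hcomm : Submodule.map₂ f D₂ Pₛ = Submodule.map₂ f Pₛ D₂ := by
    rw [← Submodule.map₂_flip f Pₛ D₂, hflip]
  have hle : Submodule.span K R ≤ S₁ ⊔ (Submodule.map₂ f Pₛ Pₛ ⊔ Submodule.map₂ f (Pₛ ⊔ D₂) D₂) := by
    refine (Submodule.span_le.2 hR).trans (sup_le_sup_left ?_ _)
    calc Submodule.map₂ f N N ≤ Submodule.map₂ f (Pₛ ⊔ D₂) (Pₛ ⊔ D₂) := Submodule.map₂_le_map₂ hN hN
      _ = Submodule.map₂ f Pₛ Pₛ ⊔ Submodule.map₂ f D₂ Pₛ ⊔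
            (Submodule.map₂ f Pₛ D₂ ⊔ Submodule.map₂ f D₂ D₂) := by
          rw [Submodule.map₂_sup_right, Submodule.map₂_sup_left, Submodule.map₂_sup_left]
      _ ≤ Submodule.map₂ f Pₛ Pₛ ⊔ Submodule.map₂ f (Pₛ ⊔ D₂) D₂ := by
          rw [hcomm, Submodule.map₂_sup_left]
          refine sup_le (sup_le le_sup_left ?_) ?_
          · exact le_sup_of_le_right le_sup_left
          · exact le_sup_right
  have hmap : (Submodule.span K R).map e ≤ (Submodule.map₂ f (Pₛ ⊔ D₂) D₂).map e := by
    refine (Submodule.map_mono hle).trans ?_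
    rw [Submodule.map_sup, Submodule.map_sup]
    have h1 : S₁.map e = ⊥ := by
      rw [eq_bot_iff, Submodule.map_le_iff_le_comap]; exact he₁
    have h2 : (Submodule.map₂ f Pₛ Pₛ).map e = ⊥ := by
      rw [eq_bot_iff, Submodule.map_le_iff_le_comap]; exact he₂
    rw [h1, h2, bot_sup_eq, bot_sup_eq]
  calc Module.rank K ((Submodule.span K R).map e)
      ≤ Module.rank K ((Submodule.map₂ f (Pₛ ⊔ D₂) D₂).map e) := Submodule.rank_mono hmap
    _ ≤ Module.rank K (Submodule.map₂ f (Pₛ ⊔ D₂) D₂) := rank_map_le e _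
    _ ≤ _ := rank_map₂_le _ _ _

/-- **F11 (formal shape, `m = 1`).** Cover the divisor classes by `N¹ ≤ Pₛ ⊔ D₂` (intended: `Pₛ` =
`L`, special divisors, theta divisors from planes split at every place of `T`; `D₂` = theta divisors
from planes anisotropic at some place of `T`); let `e` kill `SC²(D)` and `Pₛ · Pₛ` (intended: the
projector onto `Π_T`; Kudla–Millson `SC¹·SC¹ ⊆ SC² + L·H²` and the seesaw). With Lefschetz (1,1) as
hypothesis `hL`, the crux forces `rk e(Hdg^{2,2}_ℚ ⊗ ℂ) ≤ rk (Pₛ ⊔ D₂) · rk D₂`: `D₂ = 0 ≠ Π_T(K)` at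
ONE level refutes it (misstated, repair `C″`). [cite: BergeronMillsonMoeglin2016Balls, Introduction Thm 4 and Remark 3] -/
theorem rank_map_ratHodgeSpan_le_of_middleThetaSpan_one (h : MiddleThetaSpan)
    (D : UnitaryBallQuotientDatum (2 * (1 + 1)) X)
    (hL : ratHodgeSpan (2 * (1 + 1)) X (2 * 1) 1 ≤ algebraicClasses X 1)
    (Pₛ D₂ : Submodule ℂ (complexBetti X (2 * 1))) (hN : algebraicClasses X 1 ≤ Pₛ ⊔ D₂)
    (e : complexBetti X (2 * (1 + 1)) →ₗ[ℂ] complexBetti X (2 * (1 + 1)))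
    (he₁ : SC D (1 + 1) ≤ LinearMap.ker e)
    (he₂ : Submodule.map₂ (cupProduct (two_mul_add_two_mul 1 1)) Pₛ Pₛ ≤ LinearMap.ker e) :
    Module.rank ℂ ((ratHodgeSpan (2 * (1 + 1)) X (2 * (1 + 1)) (1 + 1)).map e) ≤
      Module.rank ℂ ↥(Pₛ ⊔ D₂) * Module.rank ℂ D₂ := by
  have hcomm : ∀ a b : complexBetti X (2 * 1), cupProduct (two_mul_add_two_mul 1 1) a b =
      cupProduct (two_mul_add_two_mul 1 1) b a := by
    intro a b
    have := cupProduct_gradedComm_holds (R := ℂ) (X := Motives.ComplexPoints X)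
      (two_mul_add_two_mul 1 1) (two_mul_add_two_mul 1 1) a b
    rw [this]; norm_num
  refine rank_map_span_le_of_symm_of_kills_sq (cupProduct (two_mul_add_two_mul 1 1)) hcomm
    (SC D (1 + 1)) (algebraicClasses X 1) Pₛ D₂ hN _ ?_ e he₁ he₂
  rintro c ⟨hc, hH⟩
  have hc' := h 1 X D le_rfl (by norm_num) c hc hH
  have e2 : Submodule.span ℂ {z : complexBetti X (2 * (1 + 1)) |
      ∃ s ∈ SC D 1, ∃ d ∈ algebraicClasses X 1,
        z = cupProduct (two_mul_add_two_mul 1 1) s d} = Submodule.map₂ _ (SC D 1) _ :=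
    span_cup_eq_map₂ _ _ _
  have e3 : Submodule.span ℂ {z : complexBetti X (2 * (1 + 1)) |
      ∃ a : complexBetti X (2 * 1), IsRationalClass a ∧
        IsOfHodgeType (2 * (1 + 1)) X (2 * 1) 1 1 a ∧
          ∃ d ∈ algebraicClasses X 1, z = cupProduct (two_mul_add_two_mul 1 1) a d} =
      Submodule.map₂ (cupProduct (two_mul_add_two_mul 1 1))
        (ratHodgeSpan (2 * (1 + 1)) X (2 * 1) 1) (algebraicClasses X 1) := by
    rw [← span_cup_eq_map₂_span]
    congr; ext z; simp only [Set.mem_setOf_eq, and_assoc]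
  rw [e2, e3] at hc'
  have h2 : Submodule.map₂ (cupProduct (two_mul_add_two_mul 1 1)) (SC D 1) (algebraicClasses X 1) ≤
      Submodule.map₂ (cupProduct (two_mul_add_two_mul 1 1)) (algebraicClasses X 1)
        (algebraicClasses X 1) := by
    refine Submodule.map₂_le_map₂ ?_ le_rfl
    rw [sc_eq]; exact specialCycleClasses_le_algebraicClasses D 1
  have h3 : Submodule.map₂ (cupProduct (two_mul_add_two_mul 1 1))
      (ratHodgeSpan (2 * (1 + 1)) X (2 * 1) 1) (algebraicClasses X 1) ≤
      Submodule.map₂ (cupProduct (two_mul_add_two_mul 1 1)) (algebraicClasses X 1)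
        (algebraicClasses X 1) :=
    Submodule.map₂_le_map₂ hL le_rfl
  exact sup_le (sup_le_sup_left h2 _) (h3.trans le_sup_right) hc'

end RankBound

/-! ### F6′: the all-Hodge strengthening is false at deep level (rationality is load-bearing) -/

section AllHodge

/-- HYPOTHESIS SHAPE for F6′ ("there is a non-theta `(n,n)`-class"): some datum carries a class of Hodge
type `(n,n)` seen by a linear endomorphism `e` that kills the whole three-summand span. INTENDED
INSTANCE (paper, conditional on KMSW like all of BMM): `e` = the Hecke projector onto the
`A(n,n) ⊗ π_f`-isotypic part for a STABLE tempered parameter `Ψ_{2n+1}`. Such `π` occur at every deep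
enough level (de George–Wallach limit multiplicity `m(A(n,n), Γ(𝔫)) ≍ vol ≍ N𝔫^{25}` at `p = 4`,
against `≪ N𝔫^{21+ε}` for the endoscopic shapes, Marshall–Shin Prop. singlefinite + Savin), and `e`
kills the span because every generator is THETA-ISOTYPIC: `SCⁿ_K` lies in lifts from split `U(n,n)`
(Kudla–Millson), every `(1,1)`-class is `L` or a theta lift from some `U(W₂)` (BMM Thm 4 at
`a = b = 1`, `6 < 2p+2`), and by the seesaw `θ(f₁, W₂) ∪ θ(f₂, W₂') = Σ_σ P_{U(W₂)×U(W₂')}(σ; f₁ ⊠ f₂)·Θ(σ)`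
over `σ` on `U(W₂ ⊕ W₂')` — all endoscopic (`Ψ' ⊞ χ`), never stable; `L ∪ H^{1,1}` is `A(1,1)`- or
trivial-isotypic. [cite: MarshallShin2019EndoscopyCohomologyUn1, Theorem 1.2] [cite: BergeronMillsonMoeglin2016Balls, Introduction Thm 4] -/
def HasNonThetaHodgeClass : Prop :=
  ∃ (m : ℕ) (X : Motives.SchemeOver ℂ) (D : UnitaryBallQuotientDatum (2 * (m + 1)) X),
    1 ≤ m ∧ m ≤ 2 ∧ ∃ e : complexBetti X (2 * (m + 1)) →ₗ[ℂ] complexBetti X (2 * (m + 1)),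
      SC D (m + 1) ⊔
          Submodule.span ℂ {z : complexBetti X (2 * (m + 1)) |
            ∃ s ∈ SC D m, ∃ d ∈ algebraicClasses X 1,
              z = cupProduct (two_mul_add_two_mul m 1) s d} ⊔
          Submodule.span ℂ {z : complexBetti X (2 * (m + 1)) |
            ∃ a : complexBetti X (2 * m), IsRationalClass a ∧
              IsOfHodgeType (2 * (m + 1)) X (2 * m) m m a ∧
                ∃ d ∈ algebraicClasses X 1, z = cupProduct (two_mul_add_two_mul m 1) a d} ≤
        LinearMap.ker e ∧
      ∃ c : complexBetti X (2 * (m + 1)),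
        IsOfHodgeType (2 * (m + 1)) X (2 * (m + 1)) (m + 1) (m + 1) c ∧ e c ≠ 0

/-- **F6′ (formal hook).** A non-theta `(n,n)`-class refutes the all-Hodge strengthening
`MiddleThetaSpanAllHodge` (F6); the mathematics is in `HasNonThetaHodgeClass`'s docstring: stable
`Ψ₅`-pieces carry `(2,2)`-classes invisible to special cycles AND to products of divisor classes. So any
proof of the crux must use `IsRationalClass` to exclude stable (and core) pieces — cycle 1's "presumably
load-bearing" is now "load-bearing, by the seesaw". [cite: BergeronMillsonMoeglin2016Balls, Introduction Thm 4] -/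
theorem middleThetaSpanAllHodge_false_of_hasNonThetaHodgeClass (hH : HasNonThetaHodgeClass) :
    ¬ MiddleThetaSpanAllHodge := by
  rintro hall
  obtain ⟨m, X, D, hm1, hm2, e, hker, c, hcH, hce⟩ := hH
  exact hce (LinearMap.mem_ker.1 (hker (hall m X D hm1 hm2 c hcH)))

/-- The same hook for the crux itself: a non-theta class that is moreover RATIONAL refutes
`MiddleThetaSpan`. For genuine data this needs a rational `(n,n)`-class in a stable or core piece, i.e.
a counterexample to (Hodge ⟹ Tate-type) — F5: not expected short of `¬HC`. Recorded so that the two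
hooks can be compared by type. [cite: BergeronMillsonMoeglin2016Balls, Introduction Thm 4] -/
theorem middleThetaSpan_false_of_rational_nonThetaClass
    (hH : ∃ (m : ℕ) (X : Motives.SchemeOver ℂ) (D : UnitaryBallQuotientDatum (2 * (m + 1)) X),
      1 ≤ m ∧ m ≤ 2 ∧ ∃ e : complexBetti X (2 * (m + 1)) →ₗ[ℂ] complexBetti X (2 * (m + 1)),
        SC D (m + 1) ⊔
            Submodule.span ℂ {z : complexBetti X (2 * (m + 1)) |
              ∃ s ∈ SC D m, ∃ d ∈ algebraicClasses X 1,
                z = cupProduct (two_mul_add_two_mul m 1) s d} ⊔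
            Submodule.span ℂ {z : complexBetti X (2 * (m + 1)) |
              ∃ a : complexBetti X (2 * m), IsRationalClass a ∧
                IsOfHodgeType (2 * (m + 1)) X (2 * m) m m a ∧
                  ∃ d ∈ algebraicClasses X 1, z = cupProduct (two_mul_add_two_mul m 1) a d} ≤
          LinearMap.ker e ∧
        ∃ c : complexBetti X (2 * (m + 1)), IsRationalClass c ∧
          IsOfHodgeType (2 * (m + 1)) X (2 * (m + 1)) (m + 1) (m + 1) c ∧ e c ≠ 0) :
    ¬ MiddleThetaSpan := by
  rintro h
  obtain ⟨m, X, D, hm1, hm2, e, hker, c, hc, hcH, hce⟩ := hH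
  exact hce (LinearMap.mem_ker.1 (hker (h m X D hm1 hm2 c hc hcH)))

end AllHodge

-- Targets (cycles 1–2): none (payload.stuck_stubs = []); lefschetz-one-rank-down pre-read in the module docstring.
/-! ## Cycle 3 (2026-08-16): F12 — the ε-negative GL₂-CAP kill, as a negative lemma modulo `H` -/

section EpsNegativeCAP

/-- The **decomposable middle classes** of a fourfold: ALL cup products `a ∪ b` of two degree-2 classes
(`map₂` of the cup product over `⊤ × ⊤`: contains `NS·NS`, `SC¹·N¹`, `Hdg^{1,1}_ℚ·N¹` and `H^{2,0} ∪ H^{0,2}`).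
[cite: Hatcher2002, §3.2 p. 206] -/
abbrev decomposable (X : Motives.SchemeOver ℂ) : Submodule ℂ (complexBetti X (2 * (1 + 1))) :=
  Submodule.map₂ (cupProduct (two_mul_add_two_mul 1 1)) ⊤ ⊤

/-- **`H` — a higher Blasius–Rogawski class at `p = 4`** (landed twin:
`Theorems/MiddleThetaSpan/Negative/HigherBlasiusRogawskiAtFour.lean`). Some compact arithmetic 4-ball
quotient carries a RATIONAL Hodge `(2,2)`-class outside `SC²(D) ⊔ H² ∪ H²`. The route's (rev ≤ 3) item
`HigherBlasiusRogawskiClass` (stmt-HodgeConjecture-13662, `p = 5`) one rank down, product summand widened to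
all of `H²`. Paper instance: F12 (ε-negative GL₂-CAP pieces), conditional on AMF for `ρ⊠R₂⊞χ₀` on `U(V)`.
[cite: Mok2014, Theorem 2.5.2] [cite: GanIchino2016, Theorem 1.3 and Theorem 4.4] -/
def HigherBlasiusRogawskiClassAtFour : Prop :=
  ∃ (X : Motives.SchemeOver ℂ) (D : UnitaryBallQuotientDatum (2 * (1 + 1)) X)
    (c : complexBetti X (2 * (1 + 1))), IsRationalClass c ∧
      IsOfHodgeType (2 * (1 + 1)) X (2 * (1 + 1)) (1 + 1) (1 + 1) c ∧ c ∉ SC D (1 + 1) ⊔ decomposable X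

/-- The typed span at `m = 1` sits in `SC²(D) ⊔ H² ∪ H²` (summands 2, 3 are cup products of degree-2
classes). [cite: BergeronMillsonMoeglin2016Balls, Introduction Remark 3] -/
theorem typedSpan_one_le (D : UnitaryBallQuotientDatum (2 * (1 + 1)) X) :
    SC D (1 + 1) ⊔
        Submodule.span ℂ {z : complexBetti X (2 * (1 + 1)) |
          ∃ s ∈ SC D 1, ∃ d ∈ algebraicClasses X 1, z = cupProduct (two_mul_add_two_mul 1 1) s d} ⊔
        Submodule.span ℂ {z : complexBetti X (2 * (1 + 1)) |
          ∃ a : complexBetti X (2 * 1), IsRationalClass a ∧ IsOfHodgeType (2 * (1 + 1)) X (2 * 1) 1 1 a ∧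
            ∃ d ∈ algebraicClasses X 1, z = cupProduct (two_mul_add_two_mul 1 1) a d} ≤
      SC D (1 + 1) ⊔ decomposable X := by
  refine sup_le (sup_le le_sup_left ?_) ?_
  · refine le_sup_of_le_right (Submodule.span_le.2 ?_)
    rintro z ⟨s, -, d, -, rfl⟩
    exact Submodule.apply_mem_map₂ _ Submodule.mem_top Submodule.mem_top
  · refine le_sup_of_le_right (Submodule.span_le.2 ?_)
    rintro z ⟨a, -, -, d, -, rfl⟩
    exact Submodule.apply_mem_map₂ _ Submodule.mem_top Submodule.mem_top

/-- **F12, NEGATIVE LEMMA MODULO `H`: `HigherBlasiusRogawskiClassAtFour → ¬ MiddleThetaSpan`** (instantiate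
`m = 1`). The paper discharge of `H` — ε-negative GL₂-CAP pieces: AMF parity `A_∞(−1)^{#T_δ} = ε(½, ρ×χ₀⁻¹)`,
Gan–Ichino (P2) partners `J ↔ W⁺`, `δ_ng ↔ W⁻`, incoherence ⟹ invisibility to every dim-4 theta lift — is in
the module docstring (cycle 3). [cite: BergeronMillsonMoeglin2016Balls, Introduction Thm 4 and Remark 3] -/
theorem middleThetaSpan_false_of_higherBlasiusRogawskiClassAtFour (hH : HigherBlasiusRogawskiClassAtFour) :
    ¬ MiddleThetaSpan := by
  rintro h
  obtain ⟨X, D, c, hc, hcH, hnot⟩ := hH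
  exact hnot (typedSpan_one_le D (h 1 X D le_rfl (by norm_num) c hc hcH))

/-- `H` also refutes the two-summand form (F9) and the all-Hodge strengthening (F6), both of which imply the
crux. [cite: BergeronMillsonMoeglin2016Balls, Introduction Thm 4] -/
theorem twoSummands_and_allHodge_false_of_higherBlasiusRogawskiClassAtFour
    (hH : HigherBlasiusRogawskiClassAtFour) : ¬ MiddleThetaSpanTwoSummands ∧ ¬ MiddleThetaSpanAllHodge :=
  ⟨fun h ↦ middleThetaSpan_false_of_higherBlasiusRogawskiClassAtFour hH (middleThetaSpan_of_twoSummands h),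
    fun h ↦ middleThetaSpan_false_of_higherBlasiusRogawskiClassAtFour hH (middleThetaSpan_of_allHodge h)⟩

/-- **Projector form of `H` (no extra content; the shape in which F12 delivers it).** `H` iff some datum
carries a linear endomorphism `e` of `H⁴` killing `SC²(D)` and ALL cup products of degree-2 classes, and a
rational Hodge `(2,2)`-class `c` with `e c ≠ 0` (intended `e` = the Hecke projector onto the ε-negative
GL₂-CAP piece; conversely separate `c` from the subspace by a functional). [cite: GanIchino2016, Theorem 4.4] -/
theorem higherBlasiusRogawskiClassAtFour_iff_projector :
    HigherBlasiusRogawskiClassAtFour ↔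
      ∃ (X : Motives.SchemeOver ℂ) (D : UnitaryBallQuotientDatum (2 * (1 + 1)) X)
        (e : complexBetti X (2 * (1 + 1)) →ₗ[ℂ] complexBetti X (2 * (1 + 1))),
        SC D (1 + 1) ≤ LinearMap.ker e ∧
          (∀ a b : complexBetti X (2 * 1), e (cupProduct (two_mul_add_two_mul 1 1) a b) = 0) ∧
            ∃ c : complexBetti X (2 * (1 + 1)), IsRationalClass c ∧
              IsOfHodgeType (2 * (1 + 1)) X (2 * (1 + 1)) (1 + 1) (1 + 1) c ∧ e c ≠ 0 := by
  constructor
  · rintro ⟨X, D, c, hc, hcH, hnot⟩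
    obtain ⟨f, hfc, hfS⟩ := Submodule.exists_dual_map_eq_bot_of_notMem hnot inferInstance
    have hker : SC D (1 + 1) ⊔ decomposable X ≤ LinearMap.ker f := LinearMap.le_ker_iff_map.2 hfS
    refine ⟨X, D, (LinearMap.toSpanSingleton ℂ _ c).comp f, ?_, ?_, c, hc, hcH, ?_⟩
    · intro s hs
      have : f s = 0 := LinearMap.mem_ker.1 (hker (Submodule.mem_sup_left hs))
      simp [this]
    · intro a b
      have : f (cupProduct (two_mul_add_two_mul 1 1) a b) = 0 :=
        LinearMap.mem_ker.1 (hker (Submodule.mem_sup_right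
          (Submodule.apply_mem_map₂ _ Submodule.mem_top Submodule.mem_top)))
      simp [this]
    · have hc0 : c ≠ 0 := by
        rintro rfl
        exact hnot (Submodule.zero_mem _)
      simpa [LinearMap.toSpanSingleton_apply, hc0] using hfc
  · rintro ⟨X, D, e, hSC, hcup, c, hc, hcH, hce⟩
    refine ⟨X, D, c, hc, hcH, fun hmem ↦ hce ?_⟩
    have hle : SC D (1 + 1) ⊔ decomposable X ≤ LinearMap.ker e :=
      sup_le hSC (Submodule.map₂_le.2 fun a _ b _ ↦ LinearMap.mem_ker.2 (hcup a b))
    exact LinearMap.mem_ker.1 (hle hmem)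

/-- **F12 discharges (on paper) the hypothesis of cycle 2's rational hook**: `H` implies the hypothesis of
`middleThetaSpan_false_of_rational_nonThetaClass` (an `e` killing the whole three-summand span with a rational
`(2,2)`-class outside its kernel) and a fortiori `HasNonThetaHodgeClass` (F6′). So the two hooks of §AllHodge
are now fed by ONE paper instance at FINITE level (the ε-negative CAP piece), not only by stable pieces at deep
level. [cite: BergeronMillsonMoeglin2016Balls, Introduction Thm 4] -/
theorem hasNonThetaHodgeClass_of_higherBlasiusRogawskiClassAtFour (hH : HigherBlasiusRogawskiClassAtFour) :
    HasNonThetaHodgeClass := by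
  obtain ⟨X, D, e, hSC, hcup, c, -, hcH, hce⟩ := higherBlasiusRogawskiClassAtFour_iff_projector.1 hH
  refine ⟨1, X, D, le_rfl, by norm_num, e, ?_, c, hcH, hce⟩
  have hle : SC D (1 + 1) ⊔ decomposable X ≤ LinearMap.ker e :=
    sup_le hSC (Submodule.map₂_le.2 fun a _ b _ ↦ LinearMap.mem_ker.2 (hcup a b))
  exact (typedSpan_one_le D).trans hle

/-- What `H` does NOT give formally: `¬ MiddleThetaSpanWidened` / `¬ MiddleThetaSpanOnSpecial` (F13 — the
support-widened summand `SCsupp¹` is not inside `SC² ⊔ H² ∪ H²`; on paper those repairs fall only modulo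
non-tempered GGP). Recorded as the trivially true implication in the one direction that holds:
`¬ C′ → ¬ crux` (`widened_of_middleThetaSpan`), so a future witness against `C′` is also one against the crux.
[cite: BergeronMillsonMoeglin2016Balls, Part 2 Thm 71] -/
theorem middleThetaSpan_false_of_not_widened (h : ¬ MiddleThetaSpanWidened) : ¬ MiddleThetaSpan :=
  fun hc ↦ h (widened_of_middleThetaSpan hc)

end EpsNegativeCAP

-- Targets (cycle 3): registered skeleton = Lines/conjugate-dimension-sieve.lean (6 stubs). Verdicts in the module
-- docstring: stub_singletonSpan FALSE on paper for the ε-negative GL₂-CAP idempotents (Tate type, outside typedSpan) —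
-- no unconditional `stub-false` proposal (needs AMF + a datum); evidence note `stub-doomed: stub_singletonSpan` filed.

end Summit.HodgeConjecture.HodgeConjecture.Cruxes.MiddleThetaSpan.Disproof

end
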